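import Literature.NumberTheory.Automorphic.AutomorphicFormsStableHolds
import Literature.NumberTheory.Automorphic.HarishChandraConvolutionGL
import Literature.NumberTheory.Automorphic.AutomorphicFormsL2DerivativeIntegral
import Literature.NumberTheory.Automorphic.ArchFlowParametricIntegral
import Literature.Analysis.OperatorTheory.NelsonAPrioriEstimate
import Literature.Analysis.Calculus.AnalyticOfDerivBound
import Mathlib.Analysis.Calculus.BumpFunction.FiniteDimension
import Mathlib.Analysis.Calculus.FDeriv.Pow
import Mathlib.Data.Nat.Choose.Bounds
import HarnessLib

/-!
# Harish-Chandra's regularity theorem for `K`-finite `Z(𝔤)`-finite functions on the real group,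
# along one-parameter subgroups — PROVED by Nelson's a-priori recursion

Topic `NumberTheory/Automorphic`. For the full linear group `H = GL(N, A)` over a finite-dimensional
star-formally real commutative real `*`-algebra `A` with `ℝ`-linear involution (so
`A ≅ ℝ^r × ℂ^s`, `H ≅ ∏ GL_N(ℝ) × ∏ GL_N(ℂ)`, `K = H ∩ U(N, A) ≅ ∏ O(N) × ∏ U(N)`), a smooth
right `K`-finite `Z(𝔤)`-finite `F : H → ℂ` has `t ↦ F (h exp tX)` real analytic at `t = 0` for all
`h ∈ H`, `X ∈ 𝔤` (`analyticAt_apply_expMem_smul_of_isKFinite_of_isZFinite`). This is the statement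
of the named fact `analyticAt_expMem_of_isKFinite_of_isZFinite H` that
`AutomorphicRepsGLClosureRegularity` declared and then retired (2026-08-15) as theory-sized along
the PRINTED route — analytic elliptic regularity for `Q(Ω)`, `Ω = C + 2Ω_K` (Harish-Chandra 1966,
§8; Borel 1997, Thm. 2.13 and Remark; Bump 1997, Thm. 2.9.1–2.9.2; Borel 1972, 3.14–3.15;
Hörmander, Thm. 7.5.1), absent from Mathlib. Here it is PROVED along the route the tree already
uses for the moderate growth of Lie derivatives (`AutomorphicFormsStableHolds`) and for the
analyticity of `L²`-orbits of cusp forms (`AutomorphicRepsGLAnalyticVectors`): E. Nelson's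
sum-of-squares recursion, run A PRIORI on a finite-dimensional `Δ`-stable space, with POWER
cut-off weights. It is the analytic input of Borel 1972, Thm. 3.17 (Harish-Chandra's
admissibility theorem: the closure of `U(𝔤) v` is `G`-stable for a `K`-finite `Z(𝔤)`-finite
smooth vector `v`) for functions that are not square integrable, e.g. automorphic forms that are
not cusp forms (`HarishChandraDiracGL`).

* §1 `analyticAt_of_norm_iteratedDeriv_le_on` — the local form of
  `Literature.Analysis.Calculus.analyticAt_of_norm_iteratedDeriv_le`: factorial bounds
  `‖g⁽ᵏ⁾(t)‖ ≤ M Cᵏ k!` on an INTERVAL `[t₀ - δ, t₀ + δ]` give analyticity at `t₀` (same proof;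
  Taylor's formula is only ever applied inside the interval).
* §2 `powCut`, `powWeightMap θ P hP m : V →ₗ[ℂ] L²(ℝ^d)` (`u ↦ [θ^{m+1} · P u]` for ONE bump
  function `θ`) and `exists_pow_skew_const` — the almost-skewness with LINEAR defect
  `D (m+2) ‖M_m u‖ ‖M_{m+1} w‖` (Gaffney's integration by parts:
  `∂(θ^{2m+4}) = (2m+4) θ^{2m+3} ∂θ`), i.e. the hypotheses of the a-priori recursion
  `norm_weight_wordEnd_le` of `Literature.Analysis.OperatorTheory.NelsonAPrioriEstimate` in the
  model "vector fields on a ball of `ℝ^d`" (the companion of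
  `Literature.Analysis.OperatorTheory.NelsonCutoffWeights`, whose geometric cut-offs `χ_m` have
  defect `2^m` and serve the finite-order interior estimate; `ArchAPrioriGL` has the same power
  weights on `GL_n(𝔸_K)`-orbits in linear coordinates).
* §3 generic algebra: the expansion `A_l ((∑ c_p A_p)^k f) = ∑_{|w| = k} c^w A_{l ++ w} f`
  (`wordEnd_pow_sum_smul_apply`), a coordinate size on a finite-dimensional subspace
  (`basisCoordSize`, the `coordSize` of `ArchAPrioriGL` for a general module), and the arithmetic
  of the a-priori constants: `aprioriBound B c d D n m ≤ (√B + 2 n d² c + d D (m+1))ⁿ`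
  (`aprioriBound_le_pow`), `(E (n+1))ⁿ ≤ e (E e)ⁿ n!` (`mul_succ_pow_le_factorial`),
  `(i + j)! ≤ 2^{i+j} i! j!`.
* §4 functions on `H`: `continuous_of_isArchSmooth_id` (smooth for the identity of the full linear
  group ⇒ continuous, through `contDiffAt_extend_of_isArchSmooth`) and
  `iteratedDeriv_apply_expMem_smul` (`(d/dt)^k ψ (g exp tX) = (X^k ψ)(g exp tX)`).
* §5 `analyticAt_apply_expMem_smul_of_isKFinite_of_isZFinite` — **the theorem.** `F` is killed by
  a real monic polynomial in `L_B = ∑ Bᵢ²` for an adapted basis `B` of `𝔤`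
  (`exists_adaptedBasis_real_annihilator`), so `T = span {L_B^j F}_{j<M}` is finite-dimensional
  and `L_B`-stable; in the exponential chart (`exists_chartFields`) the a-priori recursion with
  the power weights bounds the weighted local `L²`-norms of ALL words `B_α F`, `|α| = n`, by
  `R(n, n) N(F) ≤ e (E e)ⁿ n! N(F)`, uniformly on the compact arc `h exp([-1, 1] X)`; the frame
  Sobolev bound (`exists_frame_pointBound`) makes them pointwise, the expansion of `Xᵏ` into
  words gives `|(Xᵏ F)(h exp tX)| ≤ C (x E')ᵏ k!` on `|t| ≤ 1`, and §1 concludes.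

No named facts; the definitions are the proof helpers of §2–§3 (`powCut`, `powWeightFun`,
`powWeightMap`, `powEnvNorm`, `basisCoordSize`), kept in this file (D-0026).

## References

* Harish-Chandra, *Representations of a semisimple Lie group on a Banach space. I*, Trans. AMS 75
  (1953), §7 and Lemma 34 [HarishChandraTAMS1953] (held).
* Harish-Chandra, *Discrete series for semisimple Lie groups. II*, Acta Math. 116 (1966), §8
  [HarishChandra1966].
* A. Borel, *Automorphic forms on `SL₂(ℝ)`* (1997), Thm. 2.13 and Remark (p. 20), proof of
  Thm. 2.17 (a) [Borel1997] (held).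
* A. Borel, *Représentations de groupes localement compacts*, LNM 276 (1972), 3.14–3.15, Thm. 3.17
  [Borel1972] (held).
* D. Bump, *Automorphic Forms and Representations* (1997), Thm. 2.9.1–2.9.2 [Bump1997] (held).
* E. Nelson, *Analytic vectors*, Ann. of Math. 70 (1959), 572–615, §2, §6, Lemma 5.1
  [Nelson1959] (not held).
* M. P. Gaffney, *A special Stokes's theorem for complete Riemannian manifolds*, Ann. of Math. 60
  (1954), 140–145 (not held).
* S. G. Krantz, H. R. Parks, *A Primer of Real Analytic Functions*, 2nd ed. (2002), §1.2.
-/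

noncomputable section

open scoped MatrixGroups Matrix ContDiff Topology InnerProductSpace ENNReal Nat NNReal
open Filter Set MeasureTheory Metric Literature.Analysis.OperatorTheory Literature.Analysis.Calculus

namespace Literature.NumberTheory.Automorphic

/-! ## §1. Real-analyticity from factorial bounds on the derivatives on an interval -/

section LocalAnalytic


variable {E : Type*} [NormedAddCommGroup E] [NormedSpace ℝ E]

/-- Under `‖g⁽ᵏ⁾(t₀)‖ ≤ M Cᵏ k!` at the base point, the Taylor coefficients satisfy
`‖(k!)⁻¹ g⁽ᵏ⁾(t₀)‖ ≤ M |C|ᵏ`. [folklore] -/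
theorem norm_taylorCoeff_le_of_base {g : ℝ → E} {M C : ℝ} {t₀ : ℝ}
    (hb : ∀ k, ‖iteratedDeriv k g t₀‖ ≤ M * C ^ k * k !) (k : ℕ) :
    ‖((k ! : ℝ))⁻¹ • iteratedDeriv k g t₀‖ ≤ M * |C| ^ k := by
  have hM : 0 ≤ M := by simpa using (norm_nonneg _).trans (hb 0)
  have hk : (0 : ℝ) < k ! := by positivity
  rw [norm_smul, norm_inv, Real.norm_natCast, inv_mul_le_iff₀ hk]
  calc ‖iteratedDeriv k g t₀‖ ≤ M * C ^ k * k ! := hb k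
    _ ≤ M * |C| ^ k * k ! :=
        mul_le_mul_of_nonneg_right
          (mul_le_mul_of_nonneg_left ((le_abs_self _).trans_eq (abs_pow C k)) hM)
          (by positivity)
    _ = k ! * (M * |C| ^ k) := by ring

/-- The radius of convergence of the Taylor series is at least `r` whenever `(|C| + 1) r ≤ 1`,
given the factorial bounds at the base point only. [folklore] -/
theorem le_radius_taylorCoeffSeries_of_base {g : ℝ → E} {M C : ℝ} {t₀ : ℝ}
    (hb : ∀ k, ‖iteratedDeriv k g t₀‖ ≤ M * C ^ k * k !) {r : ℝ≥0}
    (hr : (|C| + 1) * r ≤ 1) : (r : ℝ≥0∞) ≤ (taylorCoeffSeries g t₀).radius := by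
  have hM : 0 ≤ M := by simpa using (norm_nonneg _).trans (hb 0)
  refine (taylorCoeffSeries g t₀).le_radius_of_bound M fun k ↦ ?_
  rw [norm_taylorCoeffSeries]
  have h1 : |C| * (r : ℝ) ≤ 1 := by nlinarith [abs_nonneg C, r.2]
  calc ‖((k ! : ℝ))⁻¹ • iteratedDeriv k g t₀‖ * (r : ℝ) ^ k ≤ M * |C| ^ k * (r : ℝ) ^ k :=
        mul_le_mul_of_nonneg_right (norm_taylorCoeff_le_of_base hb k) (by positivity)
    _ = M * (|C| * r) ^ k := by rw [mul_pow]; ring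
    _ ≤ M * 1 := mul_le_mul_of_nonneg_left (pow_le_one₀ (by positivity) h1) hM
    _ = M := mul_one M

open intervalIntegral in
/-- **Taylor's remainder bound, local form.** For smooth `g` with `‖g⁽ᵏ⁾(t)‖ ≤ M Cᵏ k!` for
`t` between `t₀` and `t₀ + y` (`y ≠ 0`),
`‖g(t₀ + y) - ∑_{k ≤ N} yᵏ (k!)⁻¹ g⁽ᵏ⁾(t₀)‖ ≤ M (N + 1) (|C| |y|)^{N+1}`
(integral form of the remainder, `taylor_integral_remainder`). [folklore] -/
theorem norm_sub_taylor_sum_le_of_uIcc [CompleteSpace E] {g : ℝ → E} (hg : ContDiff ℝ ∞ g)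
    {M C : ℝ} {t₀ y : ℝ} (hb : ∀ k, ∀ t ∈ uIcc t₀ (t₀ + y), ‖iteratedDeriv k g t‖ ≤ M * C ^ k * k !)
    (hy : y ≠ 0) (N : ℕ) :
    ‖g (t₀ + y) - ∑ k ∈ Finset.range (N + 1), y ^ k • (((k ! : ℝ))⁻¹ • iteratedDeriv k g t₀)‖ ≤
      M * (N + 1) * (|C| * |y|) ^ (N + 1) := by
  have hM : 0 ≤ M := by simpa using (norm_nonneg _).trans (hb 0 t₀ left_mem_uIcc)
  set x := t₀ + y with hx
  have hne : t₀ ≠ x := by simp [hx, hy]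
  have hU : UniqueDiffOn ℝ (uIcc t₀ x) := uniqueDiffOn_Icc (inf_lt_sup.mpr hne)
  have hgN : ContDiff ℝ (N + 1 : ℕ) g := hg.of_le (mod_cast le_top)
  -- identify Mathlib's Taylor polynomial within `uIcc t₀ x` with the unrestricted one
  have hwithin : ∀ k ≤ N + 1, ∀ t ∈ uIcc t₀ x, iteratedDerivWithin k g (uIcc t₀ x) t =
      iteratedDeriv k g t := fun k hk t ht ↦
    iteratedDerivWithin_eq_iteratedDeriv hU ((hg.of_le (mod_cast le_top)).contDiffAt) ht
  have hpoly : taylorWithinEval g N (uIcc t₀ x) t₀ x =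
      ∑ k ∈ Finset.range (N + 1), y ^ k • (((k ! : ℝ))⁻¹ • iteratedDeriv k g t₀) := by
    rw [taylor_within_apply]
    refine Finset.sum_congr rfl fun k hk ↦ ?_
    rw [hwithin k (by simp at hk; omega) t₀ left_mem_uIcc, smul_smul]
    congr 1
    rw [hx, add_sub_cancel_left, mul_comm]
  rw [← hpoly, taylor_integral_remainder hgN.contDiffOn]
  -- bound the integral remainder
  have hbound : ∀ t ∈ Set.uIoc t₀ x,
      ‖((x - t) ^ N / N !) • iteratedDerivWithin (N + 1) g (uIcc t₀ x) t‖ ≤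
        |y| ^ N / N ! * (M * |C| ^ (N + 1) * (N + 1)!) := by
    intro t ht
    have ht' : t ∈ uIcc t₀ x := uIoc_subset_uIcc ht
    rw [hwithin (N + 1) le_rfl t ht', norm_smul, norm_div, Real.norm_natCast, norm_pow,
      Real.norm_eq_abs]
    refine mul_le_mul ?_ ?_ (norm_nonneg _) (by positivity)
    · have habs : |x - t| ≤ |y| := by
        rcases mem_uIoc.mp ht with ⟨h1, h2⟩ | ⟨h1, h2⟩
        · have hy0 : 0 < y := by linarith
          rw [abs_of_pos hy0, abs_le]
          constructor <;> linarith
        · have hy0 : y < 0 := by linarith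
          rw [abs_of_neg hy0, abs_le]
          constructor <;> linarith
      exact div_le_div_of_nonneg_right (pow_le_pow_left₀ (abs_nonneg _) habs N) (by positivity)
    · calc ‖iteratedDeriv (N + 1) g t‖ ≤ M * C ^ (N + 1) * (N + 1)! := hb _ _ ht'
        _ ≤ M * |C| ^ (N + 1) * (N + 1)! :=
            mul_le_mul_of_nonneg_right
              (mul_le_mul_of_nonneg_left ((le_abs_self _).trans_eq (abs_pow C _)) hM)
              (by positivity)
  refine (norm_integral_le_of_norm_le_const hbound).trans (le_of_eq ?_)
  rw [hx, add_sub_cancel_left, Nat.factorial_succ, Nat.cast_mul, Nat.cast_add, Nat.cast_one]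
  field_simp
  ring

/-- **The Taylor series converges to `g` on a ball, local form** (`HasFPowerSeriesOnBall`): for
smooth `g : ℝ → E` (`E` complete) with `‖g⁽ᵏ⁾(t)‖ ≤ M Cᵏ k!` for all `k` and all
`t ∈ [t₀ - δ, t₀ + δ]` (`δ > 0`), the Taylor series of `g` at `t₀` sums to `g` on the ball of
radius `min δ ((|C| + 1) 2)⁻¹`. Krantz–Parks, §1.2; Harish-Chandra 1953, §7. [folklore] -/
theorem hasFPowerSeriesOnBall_of_norm_iteratedDeriv_le_on [CompleteSpace E] {g : ℝ → E}
    (hg : ContDiff ℝ ∞ g) {M C δ : ℝ} (hδ : 0 < δ) (t₀ : ℝ)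
    (hb : ∀ k, ∀ t ∈ Icc (t₀ - δ) (t₀ + δ), ‖iteratedDeriv k g t‖ ≤ M * C ^ k * k !) :
    HasFPowerSeriesOnBall g (taylorCoeffSeries g t₀) t₀
      (ENNReal.ofReal (min δ ((|C| + 1) * 2)⁻¹)) := by
  have ht₀ : t₀ ∈ Icc (t₀ - δ) (t₀ + δ) := ⟨by linarith, by linarith⟩
  have hb0 : ∀ k, ‖iteratedDeriv k g t₀‖ ≤ M * C ^ k * k ! := fun k ↦ hb k t₀ ht₀
  have hM : 0 ≤ M := by simpa using (norm_nonneg _).trans (hb0 0)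
  have hC1 : 0 < |C| + 1 := by positivity
  set ρ₁ : ℝ := ((|C| + 1) * 2)⁻¹ with hρ₁
  have hρ₁0 : 0 < ρ₁ := by positivity
  set ρ : ℝ := min δ ρ₁ with hρ
  have hρ0 : 0 < ρ := lt_min hδ hρ₁0
  have hρρ₁ : ρ ≤ ρ₁ := min_le_right _ _
  have hρδ : ρ ≤ δ := min_le_left _ _
  have hrC : (|C| + 1) * ((ρ.toNNReal : ℝ≥0) : ℝ) ≤ 1 := by
    rw [Real.coe_toNNReal ρ hρ0.le]
    calc (|C| + 1) * ρ ≤ (|C| + 1) * ρ₁ := mul_le_mul_of_nonneg_left hρρ₁ hC1.le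
      _ = 2⁻¹ := by rw [hρ₁]; field_simp
      _ ≤ 1 := by norm_num
  refine ⟨le_radius_taylorCoeffSeries_of_base hb0 hrC, ENNReal.ofReal_pos.mpr hρ0, fun {y} hy ↦ ?_⟩
  -- `|y| < ρ`, so `q = |C| |y| < 1/2` and `[t₀, t₀ + y] ⊆ [t₀ - δ, t₀ + δ]`
  have hy' : |y| < ρ := by
    rw [Metric.eball_ofReal, Metric.mem_ball, dist_zero_right, Real.norm_eq_abs] at hy
    exact hy
  have hyδ : |y| < δ := hy'.trans_le hρδ
  have hq1 : |C| * |y| < 1 := by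
    have h2 : (|C| + 1) * |y| < 1 := by
      calc (|C| + 1) * |y| < (|C| + 1) * ρ₁ := by
            exact (mul_lt_mul_of_pos_left hy' hC1).trans_le (mul_le_mul_of_nonneg_left hρρ₁ hC1.le)
        _ = 2⁻¹ := by rw [hρ₁]; field_simp
        _ ≤ 1 := by norm_num
    nlinarith [abs_nonneg C, abs_nonneg y]
  have hq0 : 0 ≤ |C| * |y| := by positivity
  have hsub : uIcc t₀ (t₀ + y) ⊆ Icc (t₀ - δ) (t₀ + δ) := by
    have h1 : -δ ≤ y ∧ y ≤ δ := by rw [← abs_le]; exact hyδ.le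
    rcases le_or_gt 0 y with hy0 | hy0
    · rw [uIcc_of_le (by linarith)]
      exact Icc_subset_Icc (by linarith) (by linarith)
    · rw [uIcc_of_ge (by linarith)]
      exact Icc_subset_Icc (by linarith) (by linarith)
  have hb' : ∀ k, ∀ t ∈ uIcc t₀ (t₀ + y), ‖iteratedDeriv k g t‖ ≤ M * C ^ k * k ! :=
    fun k t ht ↦ hb k t (hsub ht)
  simp only [taylorCoeffSeries_apply]
  rcases eq_or_ne y 0 with rfl | hy0
  · -- at `y = 0` only the constant term survives
    simpa using (hasSum_single (f := fun k : ℕ ↦ (0 : ℝ) ^ k • (((k ! : ℝ))⁻¹ •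
      iteratedDeriv k g t₀)) 0 (fun k hk ↦ by simp [zero_pow hk]))
  -- the series is absolutely convergent (geometric domination), hence has a sum
  set f : ℕ → E := fun k ↦ y ^ k • (((k ! : ℝ))⁻¹ • iteratedDeriv k g t₀) with hf
  have hfs : Summable f := by
    refine Summable.of_norm_bounded (g := fun k ↦ M * (|C| * |y|) ^ k)
      ((summable_geometric_of_lt_one hq0 hq1).mul_left M) fun k ↦ ?_
    rw [hf, norm_smul, norm_pow, Real.norm_eq_abs, mul_pow]
    calc |y| ^ k * ‖((k ! : ℝ))⁻¹ • iteratedDeriv k g t₀‖ ≤ |y| ^ k * (M * |C| ^ k) :=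
          mul_le_mul_of_nonneg_left (norm_taylorCoeff_le_of_base hb0 k) (by positivity)
      _ = M * (|C| ^ k * |y| ^ k) := by ring
  -- its partial sums tend to `g (t₀ + y)` by the remainder bound
  have hlim : Tendsto (fun N ↦ ∑ k ∈ Finset.range N, f k) atTop (𝓝 (g (t₀ + y))) := by
    rw [← tendsto_add_atTop_iff_nat 1]
    refine tendsto_iff_norm_sub_tendsto_zero.mpr ?_
    have hmaj : ∀ N, ‖∑ k ∈ Finset.range (N + 1), f k - g (t₀ + y)‖ ≤
        M * (N + 1) * (|C| * |y|) ^ (N + 1) := fun N ↦ by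
      rw [norm_sub_rev]; exact norm_sub_taylor_sum_le_of_uIcc hg hb' hy0 N
    have hzero : Tendsto (fun N : ℕ ↦ M * (N + 1) * (|C| * |y|) ^ (N + 1)) atTop (𝓝 0) := by
      have h := (tendsto_self_mul_const_pow_of_lt_one hq0 hq1).comp (tendsto_add_atTop_nat 1)
      have h' := h.const_mul M
      rw [mul_zero] at h'
      refine h'.congr fun N ↦ ?_
      simp [Function.comp, mul_assoc]
    exact squeeze_zero (fun N ↦ norm_nonneg _) hmaj hzero
  -- so the sum is `g (t₀ + y)`
  have huniq : ∑' k, f k = g (t₀ + y) :=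
    tendsto_nhds_unique hfs.hasSum.tendsto_sum_nat hlim
  exact huniq ▸ hfs.hasSum

/-- **Analyticity from factorial derivative bounds on an interval.** A smooth `g : ℝ → E`
(`E` a complete real normed space) with `‖g⁽ᵏ⁾(t)‖ ≤ M Cᵏ k!` for all `k` and all
`t ∈ [t₀ - δ, t₀ + δ]`, `δ > 0`, is real analytic at `t₀`. Krantz–Parks, §1.2; Harish-Chandra
1953, §7. [folklore] -/
theorem analyticAt_of_norm_iteratedDeriv_le_on [CompleteSpace E] {g : ℝ → E} (hg : ContDiff ℝ ∞ g)
    {M C δ : ℝ} (hδ : 0 < δ) (t₀ : ℝ)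
    (hb : ∀ k, ∀ t ∈ Icc (t₀ - δ) (t₀ + δ), ‖iteratedDeriv k g t‖ ≤ M * C ^ k * k !) :
    AnalyticAt ℝ g t₀ :=
  ⟨_, _, hasFPowerSeriesOnBall_of_norm_iteratedDeriv_le_on hg hδ t₀ hb⟩


end LocalAnalytic

/-! ## §2. Power cut-off weights on a ball of `ℝ^d` and the almost-skewness with linear defect -/

section PowerWeights


variable {d : ℕ}

/-! ### Powers of one bump function -/

/-- The power cut-off `θ^{m+1}` of a bump function `θ` centred at `0`. [folklore] -/
def powCut (θ : ContDiffBump (0 : Fin d → ℝ)) (m : ℕ) (x : Fin d → ℝ) : ℝ := θ x ^ (m + 1)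

variable (θ : ContDiffBump (0 : Fin d → ℝ))

/-- `0 ≤ θ^{m+1}`. [folklore] -/
theorem powCut_nonneg (m : ℕ) (x : Fin d → ℝ) : 0 ≤ powCut θ m x := pow_nonneg (θ.nonneg) _

/-- `θ^{m+1} ≤ 1`. [folklore] -/
theorem powCut_le_one (m : ℕ) (x : Fin d → ℝ) : powCut θ m x ≤ 1 := pow_le_one₀ θ.nonneg θ.le_one

/-- The power cut-offs decrease with the level: `θ^{m+2} ≤ θ^{m+1}`. [folklore] -/
theorem powCut_succ_le (m : ℕ) (x : Fin d → ℝ) : powCut θ (m + 1) x ≤ powCut θ m x := by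
  unfold powCut
  rw [pow_succ]
  exact mul_le_of_le_one_right (pow_nonneg θ.nonneg _) θ.le_one

/-- `θ^{m+1} = 1` on the closed ball of radius `θ.rIn`. [folklore] -/
theorem powCut_eq_one (m : ℕ) {x : Fin d → ℝ} (hx : x ∈ closedBall (0 : Fin d → ℝ) θ.rIn) :
    powCut θ m x = 1 := by
  rw [powCut, θ.one_of_mem_closedBall hx, one_pow]

/-- If `θ^{m+1}(x) ≠ 0` then `x` lies in the closed ball of radius `θ.rOut`. [folklore] -/
theorem mem_closedBall_of_powCut_ne_zero (m : ℕ) {x : Fin d → ℝ} (hx : powCut θ m x ≠ 0) :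
    x ∈ closedBall (0 : Fin d → ℝ) θ.rOut := by
  have hθ : θ x ≠ 0 := fun h ↦ hx (by simp [powCut, h])
  have hx' : x ∈ Function.support (θ : (Fin d → ℝ) → ℝ) := hθ
  rw [θ.support_eq] at hx'
  exact ball_subset_closedBall hx'

/-- `θ^{m+1}` is smooth. [folklore] -/
theorem contDiff_powCut (m : ℕ) : ContDiff ℝ ∞ (powCut θ m) := θ.contDiff.pow _

/-- `θ^{m+1}` is continuous. [folklore] -/
theorem continuous_powCut (m : ℕ) : Continuous (powCut θ m) := (contDiff_powCut θ m).continuous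

/-- `θ^{m+1}` has compact support. [folklore] -/
theorem hasCompactSupport_powCut (m : ℕ) : HasCompactSupport (powCut θ m) := by
  refine HasCompactSupport.of_support_subset_isCompact (isCompact_closedBall (0 : Fin d → ℝ) θ.rOut) ?_
  intro x hx
  exact mem_closedBall_of_powCut_ne_zero θ m hx

/-- The topological support of `θ^{m+1}` lies in the closed ball of radius `θ.rOut`. [folklore] -/
theorem tsupport_powCut_subset (m : ℕ) : tsupport (powCut θ m) ⊆ closedBall (0 : Fin d → ℝ) θ.rOut :=
  closure_minimal (fun _ hx ↦ mem_closedBall_of_powCut_ne_zero θ m hx) isClosed_closedBall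

/-! ### The power weights into `L²` -/

/-- The weighted function `θ^{m+1} · F`. [folklore] -/
def powWeightFun (m : ℕ) (F : (Fin d → ℝ) → ℂ) (x : Fin d → ℝ) : ℂ := (powCut θ m x : ℂ) * F x

/-- `‖θ^{m+1} F (x)‖ = θ^{m+1}(x) ‖F x‖`. [folklore] -/
theorem norm_powWeightFun (m : ℕ) (F : (Fin d → ℝ) → ℂ) (x : Fin d → ℝ) :
    ‖powWeightFun θ m F x‖ = powCut θ m x * ‖F x‖ := by
  rw [powWeightFun, norm_mul, Complex.norm_real, Real.norm_of_nonneg (powCut_nonneg θ m x)]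

/-- `θ^{m+1} F` is continuous for continuous `F`. [folklore] -/
theorem continuous_powWeightFun (m : ℕ) {F : (Fin d → ℝ) → ℂ} (hF : Continuous F) :
    Continuous (powWeightFun θ m F) :=
  (Complex.continuous_ofReal.comp (continuous_powCut θ m)).mul hF

/-- `θ^{m+1} F` has compact support. [folklore] -/
theorem hasCompactSupport_powWeightFun (m : ℕ) (F : (Fin d → ℝ) → ℂ) :
    HasCompactSupport (powWeightFun θ m F) := by
  have h : HasCompactSupport fun x : Fin d → ℝ ↦ ((powCut θ m x : ℝ) : ℂ) :=
    (hasCompactSupport_powCut θ m).comp_left Complex.ofReal_zero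
  exact h.mul_right

/-- `θ^{m+1} F ∈ L²` for continuous `F`. [folklore] -/
theorem memLp_powWeightFun (m : ℕ) {F : (Fin d → ℝ) → ℂ} (hF : Continuous F) :
    MemLp (powWeightFun θ m F) 2 (volume : Measure (Fin d → ℝ)) :=
  (continuous_powWeightFun θ m hF).memLp_of_hasCompactSupport (hasCompactSupport_powWeightFun θ m F)

/-- Pointwise monotonicity: `‖θ^{m+2} F (x)‖ ≤ ‖θ^{m+1} F (x)‖`. [folklore] -/
theorem norm_powWeightFun_succ_le (m : ℕ) (F : (Fin d → ℝ) → ℂ) (x : Fin d → ℝ) :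
    ‖powWeightFun θ (m + 1) F x‖ ≤ ‖powWeightFun θ m F x‖ := by
  rw [norm_powWeightFun, norm_powWeightFun]
  exact mul_le_mul_of_nonneg_right (powCut_succ_le θ m x) (norm_nonneg _)

variable {V : Type*} [AddCommGroup V] [Module ℂ V]

/-- **The power weight maps** `M_m : V → L²(ℝ^d)`, `u ↦ [θ^{m+1} · P u]`, for a complex linear
map `P : V → (ℝ^d → ℂ)` with continuous values (think: `V` a space of smooth functions on a Lie
group, `P u` the expression of `u` in an exponential chart at a base point). Nelson 1959, §6.
[folklore] -/
def powWeightMap (P : V →ₗ[ℂ] ((Fin d → ℝ) → ℂ)) (hP : ∀ u, Continuous (P u))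
    (m : ℕ) : V →ₗ[ℂ] Lp ℂ 2 (volume : Measure (Fin d → ℝ)) where
  toFun u := (memLp_powWeightFun θ m (hP u)).toLp _
  map_add' u w := by
    apply Lp.ext
    filter_upwards [(memLp_powWeightFun θ m (hP (u + w))).coeFn_toLp,
      (memLp_powWeightFun θ m (hP u)).coeFn_toLp, (memLp_powWeightFun θ m (hP w)).coeFn_toLp,
      Lp.coeFn_add ((memLp_powWeightFun θ m (hP u)).toLp _) ((memLp_powWeightFun θ m (hP w)).toLp _)]
      with x h1 h2 h3 h4
    rw [h4, Pi.add_apply, h1, h2, h3, map_add]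
    simp only [powWeightFun, Pi.add_apply, mul_add]
  map_smul' c u := by
    apply Lp.ext
    filter_upwards [(memLp_powWeightFun θ m (hP (c • u))).coeFn_toLp,
      (memLp_powWeightFun θ m (hP u)).coeFn_toLp,
      Lp.coeFn_smul c ((memLp_powWeightFun θ m (hP u)).toLp _)] with x h1 h2 h3
    rw [RingHom.id_apply, h3, Pi.smul_apply, h1, h2, map_smul]
    simp only [powWeightFun, Pi.smul_apply, smul_eq_mul]
    ring

variable (P : V →ₗ[ℂ] ((Fin d → ℝ) → ℂ)) (hP : ∀ u, Continuous (P u))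

/-- `powWeightMap m u = θ^{m+1} · P u` almost everywhere. [folklore] -/
theorem coeFn_powWeightMap (m : ℕ) (u : V) :
    (powWeightMap θ P hP m u : (Fin d → ℝ) → ℂ) =ᵐ[volume] powWeightFun θ m (P u) :=
  (memLp_powWeightFun θ m (hP u)).coeFn_toLp

/-- The norm of a power weight as an integral: `‖M_m u‖ = (∫ θ^{2m+2} |P u|²)^{1/2}`. [folklore] -/
theorem norm_powWeightMap_eq (m : ℕ) (u : V) :
    ‖powWeightMap θ P hP m u‖ = (∫ x, ‖powWeightFun θ m (P u) x‖ ^ (2 : ℝ)) ^ (1 / 2 : ℝ) :=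
  norm_toLp_eq_rpow (memLp_powWeightFun θ m (hP u))

/-- **Monotonicity of the power weights** (decreasing in the level): `‖M_{m+1} u‖ ≤ ‖M_m u‖`.
[folklore] -/
theorem norm_powWeightMap_succ_le (m : ℕ) (u : V) :
    ‖powWeightMap θ P hP (m + 1) u‖ ≤ ‖powWeightMap θ P hP m u‖ := by
  refine Lp.norm_le_norm_of_ae_le ?_
  filter_upwards [coeFn_powWeightMap θ P hP (m + 1) u, coeFn_powWeightMap θ P hP m u] with x h1 h2
  rw [h1, h2]
  exact norm_powWeightFun_succ_le θ m (P u) x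

/-- Iterated monotonicity: `‖M_m u‖ ≤ ‖M_k u‖` for `k ≤ m`. [folklore] -/
theorem norm_powWeightMap_le_of_le {k m : ℕ} (hkm : k ≤ m) (u : V) :
    ‖powWeightMap θ P hP m u‖ ≤ ‖powWeightMap θ P hP k u‖ := by
  induction m, hkm using Nat.le_induction with
  | base => exact le_rfl
  | succ m _ ih => exact (norm_powWeightMap_succ_le θ P hP m u).trans ih

/-- **Inner products of power weights are integrals**:
`⟪M_m u, M_m w⟫ = ∫ (θ^{m+1})² conj(P u) (P w)`. [folklore] -/
theorem inner_powWeightMap (m : ℕ) (u w : V) :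
    ⟪powWeightMap θ P hP m u, powWeightMap θ P hP m w⟫_ℂ =
      ∫ x, ((powCut θ m x : ℝ) : ℂ) ^ 2 * (star (P u x) * P w x) := by
  change ⟪(memLp_powWeightFun θ m (hP u)).toLp _, (memLp_powWeightFun θ m (hP w)).toLp _⟫_ℂ = _
  rw [L2.inner_def]
  refine integral_congr_ae ?_
  filter_upwards [(memLp_powWeightFun θ m (hP u)).coeFn_toLp, (memLp_powWeightFun θ m (hP w)).coeFn_toLp]
    with x h1 h2
  rw [h1, h2, RCLike.inner_apply']
  simp only [powWeightFun, Complex.star_def, map_mul, Complex.conj_ofReal]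
  ring

/-- `θ · F ∈ L²` for continuous `F` (the level-free envelope). [folklore] -/
theorem memLp_bump_mul {F : (Fin d → ℝ) → ℂ} (hF : Continuous F) :
    MemLp (fun x ↦ ((θ x : ℝ) : ℂ) * F x) 2 (volume : Measure (Fin d → ℝ)) := by
  refine ((Complex.continuous_ofReal.comp θ.continuous).mul hF).memLp_of_hasCompactSupport ?_
  exact (θ.hasCompactSupport.comp_left Complex.ofReal_zero).mul_right

/-- **The size constant** `‖[θ]‖_{L²}` of the bump function. [folklore] -/
def powEnvNorm (θ : ContDiffBump (0 : Fin d → ℝ)) : ℝ :=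
  ‖(memLp_bump_mul (d := d) θ (F := fun _ ↦ (1 : ℂ)) continuous_const).toLp _‖

/-- `0 ≤ powEnvNorm`. [folklore] -/
theorem powEnvNorm_nonneg : 0 ≤ powEnvNorm (d := d) θ := norm_nonneg _

/-- The weight of level `0` is the envelope: `‖M_0 u‖ ≤ ‖[θ · P u]‖` (in fact equality).
[folklore] -/
theorem norm_powWeightMap_zero_le (u : V) :
    ‖powWeightMap θ P hP 0 u‖ ≤ ‖(memLp_bump_mul θ (hP u)).toLp _‖ := by
  refine Lp.norm_le_norm_of_ae_le ?_
  filter_upwards [coeFn_powWeightMap θ P hP 0 u, (memLp_bump_mul θ (hP u)).coeFn_toLp] with x h1 h2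
  rw [h1, h2, norm_powWeightFun, norm_mul, Complex.norm_real, Real.norm_of_nonneg θ.nonneg, powCut,
    zero_add, pow_one]

/-- **The size of the power weights**: if `|P u| ≤ B` on the closed ball of radius `θ.rOut` then
`‖M_m u‖ ≤ B · powEnvNorm θ` for every level `m`. [folklore] -/
theorem norm_powWeightMap_le_of_bound (m : ℕ) (u : V) {B : ℝ}
    (h : ∀ x ∈ closedBall (0 : Fin d → ℝ) θ.rOut, ‖P u x‖ ≤ B) :
    ‖powWeightMap θ P hP m u‖ ≤ B * powEnvNorm (d := d) θ := by
  refine (norm_powWeightMap_le_of_le θ P hP (Nat.zero_le m) u).trans ?_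
  refine (norm_powWeightMap_zero_le θ P hP u).trans ?_
  refine Lp.norm_le_mul_norm_of_ae_le_mul ?_
  filter_upwards [(memLp_bump_mul θ (hP u)).coeFn_toLp,
    (memLp_bump_mul (d := d) θ (F := fun _ ↦ (1 : ℂ)) continuous_const).coeFn_toLp] with x h1 h2
  rw [h1, h2, norm_mul, norm_mul, norm_one, mul_one, Complex.norm_real,
    Real.norm_of_nonneg θ.nonneg, mul_comm]
  by_cases hx : x ∈ closedBall (0 : Fin d → ℝ) θ.rOut
  · exact mul_le_mul_of_nonneg_right (h x hx) θ.nonneg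
  · have hθ0 : θ x = 0 := by
      refine θ.zero_of_le_dist ?_
      rw [mem_closedBall] at hx
      exact le_of_lt (lt_of_not_ge hx)
    rw [hθ0, mul_zero, mul_zero]

/-- **Every power weight dominates the `L²`-norm on the inner ball**: `θ^{m+1} = 1` on the closed
ball of radius `θ.rIn`, so `(∫_{‖x‖ ≤ θ.rIn} ‖P u‖²)^{1/2} ≤ ‖M_m u‖`. [folklore] -/
theorem rpow_setIntegral_le_norm_powWeightMap (m : ℕ) (u : V) :
    (∫ x in closedBall (0 : Fin d → ℝ) θ.rIn, ‖P u x‖ ^ (2 : ℝ)) ^ (1 / 2 : ℝ) ≤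
      ‖powWeightMap θ P hP m u‖ := by
  rw [norm_powWeightMap_eq]
  have hint : Integrable (fun x ↦ ‖powWeightFun θ m (P u) x‖ ^ (2 : ℝ)) volume := by
    have := (memLp_powWeightFun θ m (hP u)).integrable_norm_rpow (by norm_num) (by norm_num)
    simpa using this
  refine Real.rpow_le_rpow (integral_nonneg fun x ↦ by positivity) ?_ (by norm_num)
  calc ∫ x in closedBall (0 : Fin d → ℝ) θ.rIn, ‖P u x‖ ^ (2 : ℝ)
      = ∫ x in closedBall (0 : Fin d → ℝ) θ.rIn, ‖powWeightFun θ m (P u) x‖ ^ (2 : ℝ) := by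
        refine setIntegral_congr_fun measurableSet_closedBall fun x hx ↦ ?_
        rw [norm_powWeightFun, powCut_eq_one θ m hx, one_mul]
    _ ≤ ∫ x, ‖powWeightFun θ m (P u) x‖ ^ (2 : ℝ) :=
        setIntegral_le_integral hint (Eventually.of_forall fun x ↦ by
          simp only [Pi.zero_apply]; positivity)

/-! ### Almost skewness with linear defect -/

section Skew

variable {κ : Type*} [Fintype κ] {β : Type*}

set_option maxHeartbeats 800000 in
/-- **Almost skewness of the frame derivatives for the power weights, with LINEAR defect
(Gaffney–Nelson integration by parts).** Let `(V_p)_{p ∈ κ}` be finitely many vector fields,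
smooth on the ball `‖x‖ < R₀` of `ℝ^d`, and `θ` a bump function at `0` with `θ.rOut < R₀`. Let `V`
be a complex vector space with operators `A_p`, and `(P_b)_{b ∈ β}` a family of complex linear maps
`V → C^∞(ℝ^d)` intertwining `A_p` with the derivative along `V_p` on the ball:
`P_b (A_p u) = D(P_b u)[V_p]` there. Then there is ONE constant `D ≥ 0` such that for all base
points `b`, levels `m`, indices `p` and `u, w ∈ V`,

  `|⟪M_{m+1} (A_p u), M_{m+1} w⟫ + ⟪M_{m+1} u, M_{m+1} (A_p w)⟫| ≤ D (m+2) ‖M_m u‖ ‖M_{m+1} w‖`,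

`M_m = powWeightMap θ (P_b) m`: the sum is `∫ θ^{2m+4} ∂_{V_p}(conj(P_b u) P_b w)`, which after
integration by parts (`integral_mul_fderiv_vectorField`) is bounded through
`∂_{V_p} θ^{2m+4} = (2m+4) θ^{2m+3} ∂_{V_p} θ` (one power of `θ` on the lower-order factor), the
divergence of `V_p`, `θ ≤ 1`, and Cauchy–Schwarz. This is the hypothesis `hdef` of
`norm_weight_wordEnd_le` (`NelsonAPrioriEstimate`) at level `m + 1`. Gaffney 1954; Nelson 1959,
§6. [folklore] -/
theorem exists_pow_skew_const (Vf : κ → (Fin d → ℝ) → (Fin d → ℝ)) {R₀ : ℝ}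
    (hVf : ∀ p, ContDiffOn ℝ ∞ (Vf p) (ball 0 R₀)) (θ : ContDiffBump (0 : Fin d → ℝ))
    (hθR : θ.rOut < R₀)
    (P : β → V →ₗ[ℂ] ((Fin d → ℝ) → ℂ)) (hPs : ∀ b u, ContDiff ℝ ∞ (P b u))
    (Aop : κ → Module.End ℂ V)
    (hPA : ∀ b p u, EqOn (P b (Aop p u)) (fun x ↦ fderiv ℝ (P b u) x (Vf p x)) (ball 0 R₀)) :
    ∃ D : ℝ, 0 ≤ D ∧ ∀ (b : β) (m : ℕ) (p : κ) (u w : V),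
      ‖⟪powWeightMap θ (P b) (fun u ↦ (hPs b u).continuous) (m + 1) (Aop p u),
          powWeightMap θ (P b) (fun u ↦ (hPs b u).continuous) (m + 1) w⟫_ℂ +
        ⟪powWeightMap θ (P b) (fun u ↦ (hPs b u).continuous) (m + 1) u,
          powWeightMap θ (P b) (fun u ↦ (hPs b u).continuous) (m + 1) (Aop p w)⟫_ℂ‖ ≤
      D * (m + 2) * ‖powWeightMap θ (P b) (fun u ↦ (hPs b u).continuous) m u‖ *
        ‖powWeightMap θ (P b) (fun u ↦ (hPs b u).continuous) (m + 1) w‖ := by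
  classical
  set K : Set (Fin d → ℝ) := closedBall (0 : Fin d → ℝ) θ.rOut with hK
  have hKc : IsCompact K := isCompact_closedBall _ _
  have hKO : K ⊆ ball 0 R₀ := closedBall_subset_ball hθR
  have h1top : (1 : WithTop ℕ∞) ≤ ((⊤ : ℕ∞) : WithTop ℕ∞) := by exact_mod_cast le_top
  have hVf1 : ∀ p, ContDiffOn ℝ 1 (Vf p) (ball 0 R₀) := fun p ↦ (hVf p).of_le h1top
  have hθ1 : ContDiff ℝ 1 (θ : (Fin d → ℝ) → ℝ) := θ.contDiff
  -- uniform bounds on `K`: the slope of `θ` along the fields and their divergence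
  have hcont1 : ∀ p, ContinuousOn (fun x ↦ fderiv ℝ (θ : (Fin d → ℝ) → ℝ) x (Vf p x)) K := fun p ↦
    (hθ1.continuous_fderiv one_ne_zero).continuousOn.clm_apply ((hVf p).continuousOn.mono hKO)
  obtain ⟨B₁, hB₁0, hB₁⟩ := exists_forall_norm_le_of_continuousOn hKc _ hcont1
  have hcont2 : ∀ p, ContinuousOn (fun x ↦ divV (Vf p) x) K := fun p ↦ by
    unfold divV
    refine continuousOn_finsetSum _ fun i _ ↦ ?_
    exact (continuous_apply i).comp_continuousOn
      ((((hVf1 p).continuousOn_fderiv_of_isOpen isOpen_ball le_rfl).mono hKO).clm_apply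
        continuousOn_const)
  obtain ⟨B₂, hB₂0, hB₂⟩ := exists_forall_norm_le_of_continuousOn hKc _ hcont2
  set D : ℝ := 2 * B₁ + B₂ with hD
  have hD0 : 0 ≤ D := by positivity
  refine ⟨D, hD0, fun b m p u w ↦ ?_⟩
  -- notation
  set hPc : ∀ u, Continuous (P b u) := fun u ↦ (hPs b u).continuous with hPc_def
  set F : (Fin d → ℝ) → ℂ := P b u with hF
  set G : (Fin d → ℝ) → ℂ := P b w with hG
  have hFs : ContDiff ℝ ∞ F := hPs b u
  have hGs : ContDiff ℝ ∞ G := hPs b w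
  -- membership in `K` on the support of the cut-off
  have hsuppK : ∀ x, powCut θ (m + 1) x ≠ 0 → x ∈ K := fun x hx ↦
    mem_closedBall_of_powCut_ne_zero θ (m + 1) hx
  -- `Ψ = conj F · G` and its derivative
  set Ψ : (Fin d → ℝ) → ℂ := fun x ↦ starRingEnd ℂ (F x) * G x with hΨ
  have hΨs : ContDiff ℝ ∞ Ψ := (Complex.conjCLE.contDiff.comp hFs).mul hGs
  have hΨd : ∀ x v, fderiv ℝ Ψ x v =
      starRingEnd ℂ (fderiv ℝ F x v) * G x + starRingEnd ℂ (F x) * fderiv ℝ G x v := by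
    intro x v
    have hFd : HasFDerivAt F (fderiv ℝ F x) x := (hFs.differentiable (by simp) x).hasFDerivAt
    have hGd : HasFDerivAt G (fderiv ℝ G x) x := (hGs.differentiable (by simp) x).hasFDerivAt
    have hcF : HasFDerivAt (fun y ↦ starRingEnd ℂ (F y))
        ((Complex.conjCLE : ℂ →L[ℝ] ℂ).comp (fderiv ℝ F x)) x :=
      (Complex.conjCLE : ℂ →L[ℝ] ℂ).hasFDerivAt.comp x hFd
    change fderiv ℝ ((fun y ↦ starRingEnd ℂ (F y)) * G) x v = _
    rw [(hcF.mul hGd).fderiv]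
    change starRingEnd ℂ (F x) * fderiv ℝ G x v + G x * starRingEnd ℂ (fderiv ℝ F x v) = _
    ring
  -- the cut-off `η = θ^{m+2}` and its square, as complex functions
  set η : (Fin d → ℝ) → ℝ := powCut θ (m + 1) with hη
  have hηs : ContDiff ℝ ∞ η := contDiff_powCut θ (m + 1)
  have hηd : ∀ x v, fderiv ℝ η x v = ((m + 2 : ℕ) : ℝ) * θ x ^ (m + 1) * fderiv ℝ (θ : (Fin d → ℝ) → ℝ) x v := by
    intro x v
    have hθd : HasFDerivAt (θ : (Fin d → ℝ) → ℝ) (fderiv ℝ (θ : (Fin d → ℝ) → ℝ) x) x :=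
      (hθ1.differentiable one_ne_zero x).hasFDerivAt
    have hp := hθd.pow (m + 1 + 1)
    have e : η = fun y ↦ θ y ^ (m + 1 + 1) := rfl
    rw [e, hp.fderiv]
    change ((m + 1 + 1) • θ x ^ (m + 1 + 1 - 1)) • fderiv ℝ (θ : (Fin d → ℝ) → ℝ) x v = _
    rw [nsmul_eq_mul, smul_eq_mul, Nat.add_sub_cancel]
  set G₂ : (Fin d → ℝ) → ℂ := fun x ↦ ((η x : ℝ) : ℂ) * ((η x : ℝ) : ℂ) with hG₂
  have hgs : ContDiff ℝ ∞ fun x : Fin d → ℝ ↦ ((η x : ℝ) : ℂ) :=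
    Complex.ofRealCLM.contDiff.comp hηs
  have hG₂s : ContDiff ℝ ∞ G₂ := hgs.mul hgs
  have hgc : HasCompactSupport fun x : Fin d → ℝ ↦ ((η x : ℝ) : ℂ) :=
    (hasCompactSupport_powCut θ (m + 1)).comp_left Complex.ofReal_zero
  have hG₂c : HasCompactSupport G₂ := hgc.mul_right
  have hG₂O : tsupport G₂ ⊆ ball 0 R₀ := by
    refine (closure_mono ?_).trans ((tsupport_powCut_subset θ (m + 1)).trans hKO)
    intro x hx
    have : powCut θ (m + 1) x ≠ 0 := fun h0 ↦ hx (by simp [hG₂, hη, h0])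
    exact this
  have hG₂d : ∀ x, fderiv ℝ G₂ x (Vf p x) =
      2 * ((η x : ℝ) : ℂ) * ((fderiv ℝ η x (Vf p x) : ℝ) : ℂ) := by
    intro x
    have hg : HasFDerivAt (fun y : Fin d → ℝ ↦ ((η y : ℝ) : ℂ))
        (Complex.ofRealCLM.comp (fderiv ℝ η x)) x :=
      Complex.ofRealCLM.hasFDerivAt.comp x ((hηs.differentiable (by simp) x).hasFDerivAt)
    change fderiv ℝ ((fun y : Fin d → ℝ ↦ ((η y : ℝ) : ℂ)) * fun y : Fin d → ℝ ↦ ((η y : ℝ) : ℂ)) x (Vf p x) = _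
    rw [(hg.mul hg).fderiv]
    change ((η x : ℝ) : ℂ) * ((fderiv ℝ η x (Vf p x) : ℝ) : ℂ) +
      ((η x : ℝ) : ℂ) * ((fderiv ℝ η x (Vf p x) : ℝ) : ℂ) = _
    ring
  -- (1) the sum of inner products is `∫ G₂ · DΨ[V_p]`
  have hgc2 : HasCompactSupport fun x : Fin d → ℝ ↦ ((η x : ℝ) : ℂ) ^ 2 :=
    hgc.comp_left (g := fun z : ℂ ↦ z ^ 2) (by simp)
  have hint1 : Integrable fun x ↦ ((η x : ℝ) : ℂ) ^ 2 * (star (P b (Aop p u) x) * P b w x) :=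
    ((hgs.continuous.pow 2).mul ((hPc _).star.mul (hPc _))).integrable_of_hasCompactSupport
      hgc2.mul_right
  have hint2 : Integrable fun x ↦ ((η x : ℝ) : ℂ) ^ 2 * (star (P b u x) * P b (Aop p w) x) :=
    ((hgs.continuous.pow 2).mul ((hPc _).star.mul (hPc _))).integrable_of_hasCompactSupport
      hgc2.mul_right
  have hsum : ⟪powWeightMap θ (P b) hPc (m + 1) (Aop p u), powWeightMap θ (P b) hPc (m + 1) w⟫_ℂ +
      ⟪powWeightMap θ (P b) hPc (m + 1) u, powWeightMap θ (P b) hPc (m + 1) (Aop p w)⟫_ℂ =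
      ∫ x, G₂ x * fderiv ℝ Ψ x (Vf p x) := by
    rw [inner_powWeightMap, inner_powWeightMap, ← integral_add hint1 hint2]
    refine integral_congr_ae (Eventually.of_forall fun x ↦ ?_)
    by_cases hx : powCut θ (m + 1) x = 0
    · simp [hG₂, hη, hx]
    · have hxO : x ∈ ball 0 R₀ := hKO (hsuppK x hx)
      simp only [hG₂, hη]
      rw [hΨd, hPA b p u hxO, hPA b p w hxO, Complex.star_def]
      ring
  -- (2) integration by parts
  have hIBP := integral_mul_fderiv_vectorField isOpen_ball (hVf1 p) (hΨs.of_le h1top)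
    (hG₂s.of_le h1top) hG₂c hG₂O
  -- (3) pointwise bounds of the two defect terms
  have hslope : ∀ x, powCut θ (m + 1) x ≠ 0 →
      ‖fderiv ℝ η x (Vf p x)‖ ≤ ((m : ℝ) + 2) * θ x ^ (m + 1) * B₁ := by
    intro x hx
    have hxK : x ∈ K := hsuppK x hx
    rw [hηd, norm_mul, norm_mul, Real.norm_of_nonneg (pow_nonneg θ.nonneg _), Real.norm_of_nonneg
      (by positivity)]
    push_cast
    exact mul_le_mul_of_nonneg_left (hB₁ p x hxK) (mul_nonneg (by positivity) (pow_nonneg θ.nonneg _))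
  have hboundA : ∀ x, ‖Ψ x * fderiv ℝ G₂ x (Vf p x)‖ ≤
      (2 * B₁ * ((m : ℝ) + 2)) * (‖powWeightFun θ m F x‖ * ‖powWeightFun θ (m + 1) G x‖) := by
    intro x
    by_cases hx : powCut θ (m + 1) x = 0
    · rw [hG₂d]
      have : η x = 0 := hx
      rw [this]
      simp only [Complex.ofReal_zero, mul_zero, zero_mul, norm_zero]
      positivity
    · rw [hG₂d, norm_powWeightFun, norm_powWeightFun]
      have hs := hslope x hx
      have hη0 : 0 ≤ η x := powCut_nonneg θ (m + 1) x
      have e1 : ‖Ψ x * (2 * ((η x : ℝ) : ℂ) * ((fderiv ℝ η x (Vf p x) : ℝ) : ℂ))‖ =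
          ‖F x‖ * ‖G x‖ * (2 * η x * ‖fderiv ℝ η x (Vf p x)‖) := by
        simp only [hΨ, norm_mul, Complex.norm_real, Real.norm_of_nonneg hη0, RCLike.norm_conj,
          Complex.norm_ofNat]
      rw [e1]
      have hFG : 0 ≤ ‖F x‖ * ‖G x‖ := mul_nonneg (norm_nonneg _) (norm_nonneg _)
      have hpm : powCut θ m x = θ x ^ (m + 1) := rfl
      have key : 2 * η x * ‖fderiv ℝ η x (Vf p x)‖ ≤
          2 * B₁ * ((m : ℝ) + 2) * (powCut θ m x * η x) := by
        rw [hpm]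
        have h2η : 0 ≤ 2 * η x := by positivity
        calc 2 * η x * ‖fderiv ℝ η x (Vf p x)‖ ≤ 2 * η x * (((m : ℝ) + 2) * θ x ^ (m + 1) * B₁) :=
              mul_le_mul_of_nonneg_left hs h2η
          _ = 2 * B₁ * ((m : ℝ) + 2) * (θ x ^ (m + 1) * η x) := by ring
      calc ‖F x‖ * ‖G x‖ * (2 * η x * ‖fderiv ℝ η x (Vf p x)‖)
          ≤ ‖F x‖ * ‖G x‖ * (2 * B₁ * ((m : ℝ) + 2) * (powCut θ m x * η x)) :=
            mul_le_mul_of_nonneg_left key hFG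
        _ = 2 * B₁ * ((m : ℝ) + 2) * (powCut θ m x * ‖F x‖ * (powCut θ (m + 1) x * ‖G x‖)) := by
            simp only [hη]; ring
  have hboundB : ∀ x, ‖(divV (Vf p) x : ℂ) * (Ψ x * G₂ x)‖ ≤
      (B₂ * ((m : ℝ) + 2)) * (‖powWeightFun θ m F x‖ * ‖powWeightFun θ (m + 1) G x‖) := by
    intro x
    by_cases hx : powCut θ (m + 1) x = 0
    · have : η x = 0 := hx
      simp only [hG₂, this, Complex.ofReal_zero, mul_zero, norm_zero]
      positivity
    · have hxK : x ∈ K := hsuppK x hx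
      rw [norm_powWeightFun, norm_powWeightFun]
      have hη0 : 0 ≤ η x := powCut_nonneg θ (m + 1) x
      have hη1 : η x ≤ 1 := powCut_le_one θ (m + 1) x
      have hηle : η x ≤ powCut θ m x := powCut_succ_le θ m x
      have e1 : ‖(divV (Vf p) x : ℂ) * (Ψ x * G₂ x)‖ =
          ‖divV (Vf p) x‖ * (‖F x‖ * ‖G x‖) * (η x * η x) := by
        rw [norm_mul, norm_mul, hΨ, hG₂]
        simp only [norm_mul, Complex.norm_real, Real.norm_of_nonneg hη0, RCLike.norm_conj]
        ring
      rw [e1]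
      have hb := hB₂ p x hxK
      have hFG : 0 ≤ ‖F x‖ * ‖G x‖ := mul_nonneg (norm_nonneg _) (norm_nonneg _)
      have hm2 : (1 : ℝ) ≤ (m : ℝ) + 2 := by
        have : (0 : ℝ) ≤ m := Nat.cast_nonneg m
        linarith
      have key : ‖divV (Vf p) x‖ * (η x * η x) ≤ B₂ * ((m : ℝ) + 2) * (powCut θ m x * η x) := by
        have h1 : η x * η x ≤ powCut θ m x * η x := mul_le_mul_of_nonneg_right hηle hη0
        have h0 : 0 ≤ powCut θ m x * η x := mul_nonneg (powCut_nonneg θ m x) hη0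
        calc ‖divV (Vf p) x‖ * (η x * η x) ≤ B₂ * (powCut θ m x * η x) :=
              mul_le_mul hb h1 (mul_nonneg hη0 hη0) hB₂0
          _ = B₂ * 1 * (powCut θ m x * η x) := by ring
          _ ≤ B₂ * ((m : ℝ) + 2) * (powCut θ m x * η x) :=
              mul_le_mul_of_nonneg_right (mul_le_mul_of_nonneg_left hm2 hB₂0) h0
      calc ‖divV (Vf p) x‖ * (‖F x‖ * ‖G x‖) * (η x * η x)
          = (‖divV (Vf p) x‖ * (η x * η x)) * (‖F x‖ * ‖G x‖) := by ring
        _ ≤ (B₂ * ((m : ℝ) + 2) * (powCut θ m x * η x)) * (‖F x‖ * ‖G x‖) :=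
            mul_le_mul_of_nonneg_right key hFG
        _ = B₂ * ((m : ℝ) + 2) * (powCut θ m x * ‖F x‖ * (powCut θ (m + 1) x * ‖G x‖)) := by
            simp only [hη]; ring
  -- (4) the integrable majorant and Cauchy–Schwarz
  have hmajc : Continuous fun x ↦ ‖powWeightFun θ m F x‖ * ‖powWeightFun θ (m + 1) G x‖ :=
    (continuous_powWeightFun θ m (hPc u)).norm.mul (continuous_powWeightFun θ (m + 1) (hPc w)).norm
  have hmaj : Integrable fun x ↦ ‖powWeightFun θ m F x‖ * ‖powWeightFun θ (m + 1) G x‖ :=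
    hmajc.integrable_of_hasCompactSupport ((hasCompactSupport_powWeightFun θ m F).norm.mul_right)
  have hCS : ∫ x, ‖powWeightFun θ m F x‖ * ‖powWeightFun θ (m + 1) G x‖ ≤
      ‖powWeightMap θ (P b) hPc m u‖ * ‖powWeightMap θ (P b) hPc (m + 1) w‖ := by
    have h := integral_mul_norm_le_Lp_mul_Lq (μ := (volume : Measure (Fin d → ℝ)))
      Real.HolderConjugate.two_two
      (by simpa using memLp_powWeightFun θ m (hPc u)) (by simpa using memLp_powWeightFun θ (m + 1) (hPc w))
    rw [norm_powWeightMap_eq, norm_powWeightMap_eq]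
    exact h
  -- (5) assemble
  have hA : ‖∫ x, Ψ x * fderiv ℝ G₂ x (Vf p x)‖ ≤
      (2 * B₁ * ((m : ℝ) + 2)) * ∫ x, ‖powWeightFun θ m F x‖ * ‖powWeightFun θ (m + 1) G x‖ := by
    rw [← integral_const_mul]
    exact norm_integral_le_of_norm_le (hmaj.const_mul _) (Eventually.of_forall hboundA)
  have hB : ‖∫ x, (divV (Vf p) x : ℂ) * (Ψ x * G₂ x)‖ ≤
      (B₂ * ((m : ℝ) + 2)) * ∫ x, ‖powWeightFun θ m F x‖ * ‖powWeightFun θ (m + 1) G x‖ := by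
    rw [← integral_const_mul]
    exact norm_integral_le_of_norm_le (hmaj.const_mul _) (Eventually.of_forall hboundB)
  have hI0 : 0 ≤ ∫ x, ‖powWeightFun θ m F x‖ * ‖powWeightFun θ (m + 1) G x‖ :=
    integral_nonneg fun x ↦ mul_nonneg (norm_nonneg _) (norm_nonneg _)
  have hm2 : (0 : ℝ) ≤ (m : ℝ) + 2 := by positivity
  calc _ = ‖∫ x, G₂ x * fderiv ℝ Ψ x (Vf p x)‖ := by rw [hsum]
    _ = ‖-(∫ x, Ψ x * fderiv ℝ G₂ x (Vf p x)) - ∫ x, (divV (Vf p) x : ℂ) * (Ψ x * G₂ x)‖ := by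
        rw [hIBP]
    _ ≤ ‖∫ x, Ψ x * fderiv ℝ G₂ x (Vf p x)‖ + ‖∫ x, (divV (Vf p) x : ℂ) * (Ψ x * G₂ x)‖ := by
        rw [sub_eq_add_neg, ← neg_add, norm_neg]
        exact norm_add_le _ _
    _ ≤ (2 * B₁ * ((m : ℝ) + 2) + B₂ * ((m : ℝ) + 2)) *
          ∫ x, ‖powWeightFun θ m F x‖ * ‖powWeightFun θ (m + 1) G x‖ := by
        rw [add_mul]
        exact add_le_add hA hB
    _ ≤ (2 * B₁ * ((m : ℝ) + 2) + B₂ * ((m : ℝ) + 2)) *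
          (‖powWeightMap θ (P b) hPc m u‖ * ‖powWeightMap θ (P b) hPc (m + 1) w‖) :=
        mul_le_mul_of_nonneg_left hCS
          (add_nonneg (mul_nonneg (mul_nonneg zero_le_two hB₁0) hm2) (mul_nonneg hB₂0 hm2))
    _ = _ := by rw [hD]; ring

end Skew


end PowerWeights


/-! ## §3. Generic algebra: words, a coordinate size, the arithmetic of the a-priori constants -/

section GenericAlgebra

variable {κ : Type*} {V : Type*} [AddCommGroup V] [Module ℂ V]

/-- Summing over words of length `k` and a last letter is summing over words of length `k + 1`
(values in any additive commutative monoid). [folklore] -/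
theorem sum_sum_snoc_eq' [Fintype κ] {M : Type*} [AddCommMonoid M] {k : ℕ} (g : (Fin (k + 1) → κ) → M) :
    ∑ w : Fin k → κ, ∑ p : κ, g (Fin.snoc w p) = ∑ w' : Fin (k + 1) → κ, g w' := by
  rw [← Fintype.sum_equiv (Fin.snocEquiv fun _ : Fin (k + 1) ↦ κ)
    (fun q : κ × (Fin k → κ) ↦ g (Fin.snoc q.2 q.1)) g (fun _ ↦ rfl), Fintype.sum_prod_type,
    Finset.sum_comm]

/-- `List.ofFn (Fin.snoc w p) = List.ofFn w ++ [p]` (any letters). [folklore] -/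
theorem ofFn_snoc' {k : ℕ} (w : Fin k → κ) (p : κ) :
    List.ofFn (Fin.snoc w p : Fin (k + 1) → κ) = List.ofFn w ++ [p] := by
  rw [List.ofFn_succ', List.concat_eq_append]
  simp

/-- **Expansion of the powers of a combination of letters into words**:
`A_l ((∑_p c_p A_p)^k f) = ∑_{w : Fin k → κ} (∏ᵢ c_{wᵢ}) A_{l ++ w} f`. [folklore] -/
theorem wordEnd_pow_sum_smul_apply [Fintype κ] (A : κ → Module.End ℂ V) (c : κ → ℂ) (k : ℕ)
    (l : List κ) (f : V) :
    wordEnd A l (((∑ p, c p • A p) ^ k) f) =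
      ∑ w : Fin k → κ, (∏ i, c (w i)) • wordEnd A (l ++ List.ofFn w) f := by
  induction k generalizing f with
  | zero =>
    simp only [pow_zero, Module.End.one_apply, Finset.univ_unique, Finset.sum_singleton,
      Finset.univ_eq_empty, Finset.prod_empty, one_smul, List.ofFn_zero, List.append_nil]
  | succ k ih =>
    rw [pow_succ, Module.End.mul_apply, ih]
    have hS : (∑ p, c p • A p) f = ∑ p, c p • A p f := by
      rw [LinearMap.sum_apply]
      rfl
    simp_rw [hS, wordEnd_apply_sum_smul, Finset.smul_sum, smul_smul, List.append_assoc, ← ofFn_snoc']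
    rw [← sum_sum_snoc_eq' (fun w' : Fin (k + 1) → κ ↦ (∏ i, c (w' i)) • wordEnd A (l ++ List.ofFn w') f)]
    refine Finset.sum_congr rfl fun w _ ↦ Finset.sum_congr rfl fun p _ ↦ ?_
    congr 1
    rw [Fin.prod_univ_castSucc]
    simp only [Fin.snoc_castSucc, Fin.snoc_last]

/-- The sum of `∏ᵢ a_{wᵢ}` over words of length `k` is `(∑_p a_p)^k`. [folklore] -/
theorem sum_prod_eq_sum_pow [Fintype κ] [DecidableEq κ] (a : κ → ℝ) (k : ℕ) :
    ∑ w : Fin k → κ, ∏ i, a (w i) = (∑ p, a p) ^ k := by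
  rw [Finset.sum_pow', Fintype.piFinset_univ]

end GenericAlgebra

/-! ### A size function on a finite-dimensional subspace (generic module) -/

section Size

variable {W : Type*} [AddCommGroup W] [Module ℂ W] {T : Submodule ℂ W} {ιT : Type*} [Fintype ιT]
  (bT : Module.Basis ιT ℂ T)

open scoped Classical in
/-- **The coordinate size on `T`** attached to a finite basis `bT` of `T`: the sup-norm of the
coordinates (and `0` off `T`); cf. `coordSize` of `ArchAPrioriGL` (the same for spaces of
functions on `GL_n(𝔸_K)`). [folklore] -/
def basisCoordSize (u : W) : ℝ :=
  if hu : u ∈ T then ‖bT.equivFun ⟨u, hu⟩‖ else 0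

/-- `0 ≤ basisCoordSize bT u`. [folklore] -/
theorem basisCoordSize_nonneg (u : W) : 0 ≤ basisCoordSize bT u := by
  unfold basisCoordSize; split_ifs <;> [exact norm_nonneg _; exact le_rfl]

/-- `basisCoordSize` on `T` is the norm of the coordinate vector. [folklore] -/
theorem basisCoordSize_of_mem {u : W} (hu : u ∈ T) : basisCoordSize bT u = ‖bT.equivFun ⟨u, hu⟩‖ := by
  unfold basisCoordSize; rw [dif_pos hu]

/-- **Expansion in the basis**: for `u ∈ T`, `u = ∑ⱼ cⱼ bⱼ` with `cⱼ` the coordinates. [folklore] -/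
theorem eq_sum_coord_smul_basis' {u : W} (hu : u ∈ T) :
    u = ∑ j, bT.equivFun ⟨u, hu⟩ j • ((bT j : T) : W) := by
  have e := bT.sum_equivFun ⟨u, hu⟩
  have e' := congrArg (fun v : T ↦ (v : W)) e
  simp only [Submodule.coe_sum, Submodule.coe_smul_of_tower] at e'
  exact e'.symm

/-- The coordinates are bounded by the size. [folklore] -/
theorem norm_coord_le_basisCoordSize {u : W} (hu : u ∈ T) (j : ιT) :
    ‖bT.equivFun ⟨u, hu⟩ j‖ ≤ basisCoordSize bT u := by
  rw [basisCoordSize_of_mem bT hu]; exact norm_le_pi_norm _ j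

/-- **A linear map preserving `T` is bounded for the size**:
`basisCoordSize bT (L u) ≤ B basisCoordSize bT u` on `T`. [folklore] -/
theorem exists_basisCoordSize_map_le (L : W →ₗ[ℂ] W) (hL : ∀ u ∈ T, L u ∈ T) :
    ∃ B : ℝ, 0 ≤ B ∧ ∀ u ∈ T, basisCoordSize bT (L u) ≤ B * basisCoordSize bT u := by
  let LT : T →ₗ[ℂ] T := (L.domRestrict T).codRestrict T fun u ↦ hL u u.2
  let e := bT.equivFun
  let Lc : (ιT → ℂ) →L[ℂ] (ιT → ℂ) :=
    LinearMap.toContinuousLinearMap (e.toLinearMap ∘ₗ LT ∘ₗ e.symm.toLinearMap)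
  refine ⟨‖Lc‖, norm_nonneg _, fun u hu ↦ ?_⟩
  have hLu : L u ∈ T := hL u hu
  rw [basisCoordSize_of_mem bT hLu, basisCoordSize_of_mem bT hu]
  have key : e ⟨L u, hLu⟩ = Lc (e ⟨u, hu⟩) := by
    simp only [Lc, LT, LinearMap.coe_toContinuousLinearMap', LinearMap.coe_comp, LinearEquiv.coe_coe,
      Function.comp_apply, LinearEquiv.symm_apply_apply]
    rfl
  rw [key]
  exact Lc.le_opNorm _

end Size

/-! ### Arithmetic of the a-priori constants -/

section Arith

/-- **The a-priori bounds grow at most like `(C (m+1))ⁿ`**: for nonnegative constants,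
`aprioriBound B c d D n m ≤ (√B + 2 n d² c + d D (m+1))ⁿ`. [folklore] -/
theorem aprioriBound_le_pow {B cM D : ℝ} (hcM : 0 ≤ cM) (hD : 0 ≤ D) (d : ℕ) :
    ∀ n m : ℕ, aprioriBound B cM d D n m ≤
      (Real.sqrt B + 2 * n * (d : ℝ) ^ 2 * cM + d * D * (m + 1)) ^ n := by
  intro n
  induction n with
  | zero => intro m; simp [aprioriBound]
  | succ n ih =>
    intro m
    have hg0 : ∀ n' m' : ℕ, 0 ≤ Real.sqrt B + 2 * n' * (d : ℝ) ^ 2 * cM + d * D * (m' + 1) :=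
      fun n' m' ↦ by positivity
    -- monotonicity of the base in `n` and `m`
    have hmono : ∀ {n₁ n₂ m₁ m₂ : ℕ}, n₁ ≤ n₂ → m₁ ≤ m₂ →
        Real.sqrt B + 2 * n₁ * (d : ℝ) ^ 2 * cM + d * D * (m₁ + 1) ≤
          Real.sqrt B + 2 * n₂ * (d : ℝ) ^ 2 * cM + d * D * (m₂ + 1) := by
      intro n₁ n₂ m₁ m₂ hn hm
      have hn' : (n₁ : ℝ) ≤ n₂ := by exact_mod_cast hn
      have hm' : (m₁ : ℝ) ≤ m₂ := by exact_mod_cast hm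
      have h1 : 2 * (n₁ : ℝ) * (d : ℝ) ^ 2 * cM ≤ 2 * n₂ * (d : ℝ) ^ 2 * cM := by
        have : 0 ≤ (d : ℝ) ^ 2 * cM := by positivity
        nlinarith
      have h2 : (d : ℝ) * D * (m₁ + 1) ≤ d * D * (m₂ + 1) := by
        have : 0 ≤ (d : ℝ) * D := by positivity
        nlinarith
      linarith
    set g : ℝ := Real.sqrt B + 2 * ((n + 1 : ℕ) : ℝ) * (d : ℝ) ^ 2 * cM + d * D * (m + 1) with hg
    have hgn : 0 ≤ g := hg0 _ _
    have hR1 : aprioriBound B cM d D n m ≤ g ^ n :=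
      (ih m).trans (pow_le_pow_left₀ (hg0 n m) (hmono (Nat.le_succ n) le_rfl) n)
    have hR2 : aprioriBound B cM d D n (m - 1) ≤ g ^ n :=
      (ih (m - 1)).trans (pow_le_pow_left₀ (hg0 n (m - 1)) (hmono (Nat.le_succ n) (Nat.sub_le m 1)) n)
    have hf : Real.sqrt B + 2 * n * (d : ℝ) ^ 2 * cM + d * D * (m + 1) ≤ g :=
      hmono (Nat.le_succ n) le_rfl
    have hmax : max (aprioriBound B cM d D n m) (aprioriBound B cM d D n (m - 1)) ≤ g ^ n :=
      max_le hR1 hR2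
    have hmax0 : 0 ≤ max (aprioriBound B cM d D n m) (aprioriBound B cM d D n (m - 1)) :=
      le_max_of_le_left (aprioriBound_nonneg hcM hD d n m)
    calc aprioriBound B cM d D (n + 1) m
        = (Real.sqrt B + 2 * n * (d : ℝ) ^ 2 * cM + d * D * (m + 1)) *
            max (aprioriBound B cM d D n m) (aprioriBound B cM d D n (m - 1)) := by
          simp only [aprioriBound]
      _ ≤ g * g ^ n := mul_le_mul hf hmax hmax0 hgn
      _ = g ^ (n + 1) := by ring

/-- The diagonal a-priori bounds are at most `(E (n+1))ⁿ` with `E = √B + 2 d² c + d D`. [folklore] -/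
theorem aprioriBound_diag_le {B cM D : ℝ} (hcM : 0 ≤ cM) (hD : 0 ≤ D) (d n : ℕ) :
    aprioriBound B cM d D n n ≤
      ((Real.sqrt B + 2 * (d : ℝ) ^ 2 * cM + d * D) * (n + 1)) ^ n := by
  refine (aprioriBound_le_pow hcM hD d n n).trans (pow_le_pow_left₀ (by positivity) ?_ n)
  have hn : (0 : ℝ) ≤ n := Nat.cast_nonneg n
  have h1 : Real.sqrt B ≤ Real.sqrt B * (n + 1) := le_mul_of_one_le_right (Real.sqrt_nonneg B) (by linarith)
  have h2 : 2 * (n : ℝ) * (d : ℝ) ^ 2 * cM ≤ 2 * (d : ℝ) ^ 2 * cM * (n + 1) := by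
    have : 0 ≤ (d : ℝ) ^ 2 * cM := by positivity
    nlinarith
  nlinarith [h1, h2]

/-- `(n + 1)ⁿ ≤ e^{n+1} n!` (from `xᵏ / k! ≤ eˣ` at `x = k = n + 1`). [folklore] -/
theorem pow_succ_self_le_exp_mul_factorial (n : ℕ) :
    ((n : ℝ) + 1) ^ n ≤ Real.exp (n + 1) * n ! := by
  have h := Real.pow_div_factorial_le_exp (x := (n : ℝ) + 1) (by positivity) (n + 1)
  have hfac : (0 : ℝ) < (n + 1)! := by positivity
  rw [div_le_iff₀ hfac] at h
  have hn1 : (0 : ℝ) < n + 1 := by positivity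
  rw [Nat.factorial_succ, Nat.cast_mul, Nat.cast_succ, pow_succ] at h
  -- `h : (n+1)^n * (n+1) ≤ exp (n+1) * ((n+1) * n!)`
  nlinarith [h, Real.exp_pos ((n : ℝ) + 1), (Nat.cast_nonneg (α := ℝ) n !)]

/-- `(E (n+1))ⁿ ≤ e (E e)ⁿ n!` for `E ≥ 0`. [folklore] -/
theorem mul_succ_pow_le_factorial {E : ℝ} (hE : 0 ≤ E) (n : ℕ) :
    (E * (n + 1)) ^ n ≤ Real.exp 1 * (E * Real.exp 1) ^ n * n ! := by
  rw [mul_pow, mul_pow]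
  have h := pow_succ_self_le_exp_mul_factorial n
  have hexp : Real.exp ((n : ℝ) + 1) = Real.exp 1 * Real.exp 1 ^ n := by
    rw [← Real.exp_nat_mul, ← Real.exp_add]; ring_nf
  rw [hexp] at h
  calc E ^ n * ((n : ℝ) + 1) ^ n ≤ E ^ n * (Real.exp 1 * Real.exp 1 ^ n * n !) :=
        mul_le_mul_of_nonneg_left h (pow_nonneg hE n)
    _ = Real.exp 1 * (E ^ n * Real.exp 1 ^ n) * n ! := by ring

/-- `(i + j)! ≤ 2^{i+j} i! j!` (real form). [folklore] -/
theorem factorial_add_le_two_pow_mul (i j : ℕ) :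
    (((i + j)! : ℕ) : ℝ) ≤ (2 : ℝ) ^ (i + j) * i ! * j ! := by
  have h := Nat.add_choose_mul_factorial_mul_factorial i j
  have hc := Nat.choose_le_two_pow (i + j) j
  have h' : ((i + j)! : ℕ) ≤ 2 ^ (i + j) * i ! * j ! := by
    calc (i + j)! = (i + j).choose j * i ! * j ! := h.symm
      _ ≤ 2 ^ (i + j) * i ! * j ! := by gcongr
  exact_mod_cast h'

end Arith

/-! ## §4. Functions on the full linear real group: continuity and derivatives along `exp tX` -/

-- Mathlib idiom (Mathlib/Algebra/Lie/OfAssociative.lean); needed to mention Lie subalgebras of matrix algebras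
attribute [local instance 100] LieRing.ofAssociativeRing

section Group

variable {A : Type*} [NormedCommRing A] [NormedAlgebra ℝ A] [NormedAlgebra ℚ A] [CompleteSpace A]
  [StarRing A] {N : Type*} [Fintype N] [DecidableEq N] {H : RealMatrixGroup A N}

open scoped Matrix.Norms.Operator in
/-- **Smooth functions on the full linear group are continuous** (functions on `H` itself): if
`H.lie = ⊤`, `H.carrier = ⊤` and `ψ : H → ℂ` is smooth in the sense of `IsArchSmooth` for the
identity of `H`, then `ψ` is continuous (it is `C^∞` on the open set of invertible matrices,
`contDiffAt_extend_of_isArchSmooth`). [folklore] -/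
theorem continuous_of_isArchSmooth_id [FiniteDimensional ℝ A] (hH : H.lie = ⊤) (hc : H.carrier = ⊤)
    {ψ : H.carrier → ℂ} (hψ : IsArchSmooth (MonoidHom.id H.carrier) ψ) : Continuous ψ := by
  classical
  have hu : ∀ u : GL N A, u ∈ H.carrier := fun u ↦ by rw [hc]; exact Subgroup.mem_top u
  let α : GL N A → ℂ := fun u ↦ ψ ⟨u, hu u⟩
  have hα : IsArchSmooth H.carrier.subtype α := by
    intro g
    have h := hψ ⟨g, hu g⟩
    have e : (fun X : H.lie.toSubmodule ↦ α (g * H.carrier.subtype (H.expMem ⟨X, X.2⟩))) =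
        fun X : H.lie.toSubmodule ↦ ψ (⟨g, hu g⟩ * (MonoidHom.id H.carrier) (H.expMem ⟨X, X.2⟩)) := by
      funext X; rfl
    rw [e]
    exact h
  have hext : ∀ u₀ : GL N A, ContDiffAt ℝ ∞
      (fun M : Matrix N N A ↦ α (if h : IsUnit M then h.unit else 1)) (u₀ : Matrix N N A) := fun u₀ ↦
    contDiffAt_extend_of_isArchSmooth hH hα u₀
  have heq : ψ = (fun M : Matrix N N A ↦ α (if h : IsUnit M then h.unit else 1)) ∘
      (fun p : H.carrier ↦ ((p : GL N A) : Matrix N N A)) := by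
    funext p
    simp only [Function.comp_apply, dif_pos (Units.isUnit (p : GL N A)), IsUnit.unit_of_val_units, α]
  have hcont : Continuous (fun p : H.carrier ↦ ((p : GL N A) : Matrix N N A)) :=
    Units.continuous_val.comp continuous_subtype_val
  rw [heq]
  exact continuous_iff_continuousAt.2 fun p ↦
    ContinuousAt.comp (f := fun p : H.carrier ↦ ((p : GL N A) : Matrix N N A)) (x := p)
      (hext p).continuousAt hcont.continuousAt

variable {G : Type*} [Group G] (ι : H.carrier →* G)

/-- Iterated Lie derivatives stay smooth: `(X)^{∘k} ψ` is archimedean-smooth. [folklore] -/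
theorem isArchSmooth_iterate_lieDeriv [FiniteDimensional ℝ A] (X : H.lie) {ψ : G → ℂ}
    (hψ : IsArchSmooth ι ψ) (k : ℕ) : IsArchSmooth ι ((lieDeriv ι X)^[k] ψ) := by
  induction k with
  | zero => simpa using hψ
  | succ k ih =>
    rw [Function.iterate_succ', Function.comp_apply]
    exact isArchSmooth_lieDeriv_of_isArchSmooth ι X ih

/-- **The iterated derivatives of `t ↦ ψ (g exp tX)` are the iterated Lie derivatives read on the
curve**: `(d/dt)^k ψ (g exp tX) = (X^k ψ)(g exp tX)`. Borel–Jacquet 1979, §1.5. [folklore] -/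
theorem iteratedDeriv_apply_expMem_smul [FiniteDimensional ℝ A] {ψ : G → ℂ} (hψ : IsArchSmooth ι ψ)
    (X : H.lie) (g : G) (k : ℕ) :
    iteratedDeriv k (fun t : ℝ ↦ ψ (g * ι (H.expMem (t • X)))) =
      fun t ↦ ((lieDeriv ι X)^[k] ψ) (g * ι (H.expMem (t • X))) := by
  induction k with
  | zero => simp
  | succ k ih =>
    rw [iteratedDeriv_succ, ih]
    funext t
    rw [Function.iterate_succ', Function.comp_apply]
    exact ((isArchSmooth_iterate_lieDeriv ι X hψ k).hasDerivAt_expMem_smul ι X g t).deriv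

end Group


/-! ## §5. Harish-Chandra's regularity theorem along one-parameter subgroups -/

section Main

variable {A : Type*} [NormedCommRing A] [NormedAlgebra ℝ A] [NormedAlgebra ℚ A] [CompleteSpace A]
  [StarRing A] {N : Type*} [Fintype N] [DecidableEq N]

/-- Powers of the operator `ρ X` on `archSmooth` are the iterated Lie derivatives. [folklore] -/
theorem coe_pow_lieHom_apply {H : RealMatrixGroup A N} {G : Type*} [Group G] {ι : H.carrier →* G}
    (ρ : H.lie →ₗ⁅ℝ⁆ Module.End ℂ (archSmooth ι))
    (hρ : ∀ (X : H.lie) (ψ : archSmooth ι), ((ρ X ψ : archSmooth ι) : G → ℂ) = lieDeriv ι X ψ)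
    (X : H.lie) (k : ℕ) (v : archSmooth ι) :
    ((((ρ X) ^ k) v : archSmooth ι) : G → ℂ) = (lieDeriv ι X)^[k] (v : G → ℂ) := by
  induction k with
  | zero => simp
  | succ k ih =>
    rw [pow_succ', Module.End.mul_apply, hρ, ih, Function.iterate_succ', Function.comp_apply]

/-- **A smooth `K`-finite `Z(𝔤)`-finite function is annihilated by a real monic polynomial in a sum
of squares of a basis of `𝔤`**, for a `*`-stable Lie algebra and a basis indexed by `Fin d` (the
shape consumed by `ArchimedeanExpChart`; `IsAutomorphicForm.exists_elliptic_annihilator` is the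
same for automorphic forms of a regular datum): `∑ⱼ rⱼ L_B^j φ = 0`, `r_M = 1`,
`L_B ψ = ∑ᵢ Bᵢ (Bᵢ ψ)`, i.e. `∑ⱼ rⱼ L_B^j ψ₀ = 0` (`exists_adaptedBasis_real_annihilator`, reindexed). Borel 1972, 3.15;
Harish-Chandra 1966, §8; Nelson 1959, §8. [cite: Borel1972, 3.15] -/
theorem exists_basis_real_annihilator [FiniteDimensional ℝ A] [StarModule ℝ A] [ContinuousStar A]
    {H : RealMatrixGroup A N} {G : Type*} [Group G] (ι : H.carrier →* G)
    {tr : A →ₗ[ℝ] ℝ} (htr : ∀ a, tr (star a) = tr a) (hpos : ∀ a : A, a ≠ 0 → 0 < tr (star a * a))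
    (hstar : ∀ X : H.lie, star (X : Matrix N N A) ∈ H.lie)
    {ψ₀ : G → ℂ} (hψ₀ : IsArchSmooth ι ψ₀) (hK : IsKFinite ι ψ₀) (hZ : IsZFinite ι ψ₀) :
    ∃ (d : ℕ) (B : Module.Basis (Fin d) ℝ H.lie.toSubmodule) (M : ℕ) (r : ℕ → ℝ), r M = 1 ∧
      ∀ x, ∑ j ∈ Finset.range (M + 1), (r j : ℂ) * ((sqSumOp ι (basisLie B))^[j] ψ₀) x = 0 := by
  obtain ⟨n, m, c, -, -, -, M, r, hr1, hr⟩ :=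
    exists_adaptedBasis_real_annihilator ι htr hpos hstar hψ₀ hK hZ
  -- reindex by `Fin (n + m)` and transport to the submodule
  let B : Module.Basis (Fin (n + m)) ℝ H.lie.toSubmodule :=
    (c.reindex finSumFinEquiv).map (lieEquivSubmodule H)
  have hB : ∀ i, basisLie B i = c (finSumFinEquiv.symm i) := fun i ↦ by
    refine Subtype.ext ?_
    rw [coe_basisLie]
    change ((lieEquivSubmodule H (c.reindex finSumFinEquiv i) : H.lie.toSubmodule) :
      Matrix N N A) = _
    rw [coe_lieEquivSubmodule, Module.Basis.reindex_apply]
  have hop : sqSumOp ι (basisLie B) = sqSumOp ι c := by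
    funext ψ
    unfold sqSumOp
    simp only [hB]
    exact Equiv.sum_comp finSumFinEquiv.symm (fun s ↦ iterLieDeriv ι [c s, c s] ψ)
  refine ⟨n + m, B, M, r, hr1, fun x ↦ ?_⟩
  have h := congrFun hr x
  rw [Finset.sum_apply] at h
  simpa only [hop, Pi.smul_apply, smul_eq_mul, Pi.zero_apply] using h

set_option maxHeartbeats 4000000 in
/-- **Harish-Chandra's regularity theorem for `K`-finite `Z(𝔤)`-finite functions on the real
group, one-parameter form, PROVED.** For the full linear group `H = GL(N, A)` (`H.lie = ⊤`,
`H.carrier = ⊤`) over a finite-dimensional star-formally real `A` with `ℝ`-linear involution, a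
smooth (`IsArchSmooth`), right-`K`-finite (`IsKFinite`), `Z(𝔤)`-finite (`IsZFinite`) function
`F : H → ℂ` (the three notions of `ArchimedeanCalculus` for `ι = MonoidHom.id H`) is real analytic
along every one-parameter subgroup: `t ↦ F (h exp tX)` is analytic at `0` for all `h ∈ H`,
`X ∈ 𝔤`. This is, verbatim, the statement of the named fact
`analyticAt_expMem_of_isKFinite_of_isZFinite H` formerly declared in
`AutomorphicRepsGLClosureRegularity` (retired there on 2026-08-15 as theory-sized along the printed
route), now a theorem.

Proof (Nelson's a-priori recursion in place of analytic elliptic regularity). `F` is killed by a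
real monic polynomial in the sum of squares `L_B` of an adapted basis `B` of `𝔤`
(`exists_adaptedBasis_real_annihilator`: `Z(𝔤)`- and `K`-finiteness), so the span `T` of the
`L_B^j F`, `j < M`, is a finite-dimensional `L_B`-stable space of smooth functions. In the
exponential chart at a base point `y` the Lie derivatives are vector fields
(`ArchimedeanExpChart`), and the POWER weights `θ^{m+1}` of one bump function are monotone and
almost skew with LINEAR defect (`exists_pow_skew_const`), so Nelson's a-priori recursion
(`norm_weight_wordEnd_le`) bounds the weighted local `L²`-norms of ALL words of length `n` in the
`Bᵢ` applied to `F` by `R(n, n) · N(F)` with `R(n, n) ≤ (E (n+1))ⁿ ≤ e (E e)ⁿ n!`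
(`aprioriBound_diag_le`), uniformly for `y` in the compact arc `h exp([-1, 1] X)`. The frame
Sobolev bound (`exists_frame_pointBound`) turns these into pointwise bounds
`|(B_γ F)(y)| ≤ C_P E_Pⁿ n!` for words `γ` of length `n`, the expansion
`Xᵏ = ∑_{|β| = k} x^β B_β` gives `|(Xᵏ F)(h exp tX)| ≤ C_P (x E_P)ᵏ k!` for `|t| ≤ 1`, and these are
the iterated derivatives of `t ↦ F (h exp tX)` (`iteratedDeriv_apply_expMem_smul`); Taylor's
formula (`analyticAt_of_norm_iteratedDeriv_le_on`) concludes. In print: Harish-Chandra 1953,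
Lemma 34 / Harish-Chandra 1966, §8, via analytic elliptic regularity (Borel 1997, Thm. 2.13 and
Remark; Bump 1997, Thm. 2.9.1–2.9.2; Borel 1972, 3.14–3.15); here by Nelson 1959, §6.
[cite: Borel1997, Thm. 2.13 and Remark (p. 20)] -/
theorem analyticAt_apply_expMem_smul_of_isKFinite_of_isZFinite [FiniteDimensional ℝ A] [StarModule ℝ A]
    (H : RealMatrixGroup A N) (hA : IsStarFormallyReal A) (hH : H.lie = ⊤) (hc : H.carrier = ⊤)
    {F : H.carrier → ℂ} (hFs : IsArchSmooth (MonoidHom.id H.carrier) F)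
    (hFK : IsKFinite (MonoidHom.id H.carrier) F) (hFZ : IsZFinite (MonoidHom.id H.carrier) F)
    (h : H.carrier) (X : H.lie) :
    AnalyticAt ℝ (fun t : ℝ ↦ F (h * H.expMem (t • X))) 0 := by
  classical
  set ι : H.carrier →* H.carrier := MonoidHom.id H.carrier with hι
  -- `star` is `ℝ`-linear on the finite-dimensional `A`, hence continuous
  haveI : ContinuousStar A := by
    refine ⟨?_⟩
    let σ : A →ₗ[ℝ] A :=
      { toFun := star
        map_add' := star_add
        map_smul' := fun r a ↦ by rw [star_smul, star_trivial]; rfl }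
    exact σ.continuous_of_finiteDimensional
  /- Step 0: the curve, its smoothness and its iterated derivatives -/
  set curve : ℝ → ℂ := fun t ↦ F (h * H.expMem (t • X)) with hcurve_def
  have hcurve_eq : curve = fun t ↦ F (h * ι (H.expMem (t • X))) := rfl
  have hsmooth : ContDiff ℝ ∞ curve := by rw [hcurve_eq]; exact hFs.contDiff_expMem_smul ι X h
  have hiter : ∀ k, iteratedDeriv k curve = fun t ↦ ((lieDeriv ι X)^[k] F) (h * ι (H.expMem (t • X))) :=
    fun k ↦ by rw [hcurve_eq]; exact iteratedDeriv_apply_expMem_smul ι hFs X h k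
  /- Step 1: the elliptic annihilator `∑ⱼ rⱼ L_B^j F = 0`, `r_M = 1`, for a basis indexed by `Fin d` -/
  have htr : ∀ a : A, Algebra.trace ℝ A (star a) = Algebra.trace ℝ A a := trace_star
  have hpos : ∀ a : A, a ≠ 0 → 0 < Algebra.trace ℝ A (star a * a) := fun a ha ↦ by
    rw [mul_comm]; exact hA.trace_mul_star_self_pos ha
  have hmemlie : ∀ M : Matrix N N A, M ∈ H.lie := fun M ↦ by rw [hH]; exact LieSubalgebra.mem_top M
  have hstar : ∀ Y : H.lie, star (Y : Matrix N N A) ∈ H.lie := fun Y ↦ hmemlie _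
  obtain ⟨d, B, Mdeg, r, hrM, hann'⟩ :=
    exists_basis_real_annihilator ι htr hpos hstar hFs hFK hFZ
  /- Step 2: the exponential chart of `B` and its fields -/
  have hreg : ∀ Y : Matrix N N A, (∀ t : ℝ, expGL (t • Y) ∈ H.carrier) → Y ∈ H.lie :=
    fun Y _ ↦ hmemlie Y
  obtain ⟨Ξ, Ω₀, hΞs, hΞ0, hΩ₀, h0Ω₀, hΞ⟩ := exists_chartFields (ι := ι) hreg B
  obtain ⟨R₀, hR₀, hballΩ⟩ := Metric.isOpen_iff.1 hΩ₀ 0 h0Ω₀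
  /- Step 3: the Lie algebra representation on smooth functions and Nelson's family -/
  obtain ⟨ρ, hρ⟩ := exists_lieHom_lieDeriv ι
  set Aop : Fin d → Module.End ℂ (archSmooth ι) := fun i ↦ ρ (basisLie B i) with hAop_def
  set eqv := lieEquivSubmodule H
  set cst : Fin d → Fin d → Fin d → ℝ := fun i m l ↦ B.repr (eqv ⁅basisLie B i, basisLie B m⁆) l
  have hbasis : ∀ Y : H.lie, Y = ∑ l, (B.repr (eqv Y) l) • basisLie B l := by
    intro Y
    have h1 : eqv Y = ∑ l, (B.repr (eqv Y) l) • B l := (B.sum_repr (eqv Y)).symm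
    have h2 : Y = eqv.symm (eqv Y) := (eqv.symm_apply_apply Y).symm
    conv_lhs => rw [h2, h1, map_sum]
    refine Finset.sum_congr rfl fun l _ ↦ ?_
    rw [map_smul]
    congr 1
  have hbr : ∀ i m, Aop i * Aop m - Aop m * Aop i = ∑ l, (cst i m l : ℂ) • Aop l := by
    intro i m
    have h1 : ρ (basisLie B i) * ρ (basisLie B m) - ρ (basisLie B m) * ρ (basisLie B i) =
        ρ ⁅basisLie B i, basisLie B m⁆ := by
      rw [LieHom.map_lie, LieRing.of_associative_ring_bracket]
    change ρ (basisLie B i) * ρ (basisLie B m) - ρ (basisLie B m) * ρ (basisLie B i) =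
      ∑ l, (cst i m l : ℂ) • ρ (basisLie B l)
    rw [h1]
    conv_lhs => rw [hbasis ⁅basisLie B i, basisLie B m⁆]
    rw [map_sum]
    refine Finset.sum_congr rfl fun l _ ↦ ?_
    rw [map_smul, real_smul_end_eq_coe_smul]
  set cM : ℝ := ∑ i, ∑ m, ∑ l, |cst i m l| with hcM_def
  have hcM0 : 0 ≤ cM := Finset.sum_nonneg fun _ _ ↦ Finset.sum_nonneg fun _ _ ↦
    Finset.sum_nonneg fun _ _ ↦ abs_nonneg _
  have hcle : ∀ i m l, |cst i m l| ≤ cM := by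
    intro i m l
    calc |cst i m l| ≤ ∑ l', |cst i m l'| :=
          Finset.single_le_sum (f := fun l' ↦ |cst i m l'|) (fun _ _ ↦ abs_nonneg _) (Finset.mem_univ l)
      _ ≤ ∑ m', ∑ l', |cst i m' l'| :=
          Finset.single_le_sum (f := fun m' ↦ ∑ l', |cst i m' l'|)
            (fun _ _ ↦ Finset.sum_nonneg fun _ _ ↦ abs_nonneg _) (Finset.mem_univ m)
      _ ≤ cM := Finset.single_le_sum (f := fun i' ↦ ∑ m', ∑ l', |cst i' m' l'|)
            (fun _ _ ↦ Finset.sum_nonneg fun _ _ ↦ Finset.sum_nonneg fun _ _ ↦ abs_nonneg _)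
            (Finset.mem_univ i)
  /- Step 4: chart expressions `P_y v = (x ↦ v (y exp ∑ xᵢBᵢ))` and their derivatives -/
  set P : H.carrier → (archSmooth ι) →ₗ[ℂ] ((Fin d → ℝ) → ℂ) := fun y ↦
    { toFun := fun v ↦ chartFun ι B (v : H.carrier → ℂ) y
      map_add' := fun v w ↦ rfl
      map_smul' := fun a v ↦ rfl } with hP_def
  have hP_apply : ∀ y v x, P y v x = (v : H.carrier → ℂ) (y * ι (chartExp B x)) := fun _ _ _ ↦ rfl
  have hPs : ∀ y v, ContDiff ℝ ∞ (P y v) := fun y v ↦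
    contDiff_chartFun B ((mem_archSmooth_iff _ _).1 v.2) y
  have hPA : ∀ y p v, EqOn (P y (Aop p v)) (fun x ↦ fderiv ℝ (P y v) x (Ξ p x)) (ball 0 R₀) := by
    intro y p v x hx
    change ((ρ (basisLie B p) v : archSmooth _) : H.carrier → ℂ) (y * ι (chartExp B x)) =
      fderiv ℝ (chartFun ι B (v : H.carrier → ℂ) y) x (Ξ p x)
    rw [hρ, fderiv_chartFun_chartField hΞ ((mem_archSmooth_iff _ _).1 v.2) y p (hballΩ hx)]
  /- Step 5: the Sobolev radius, the bump function and the power weights -/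
  obtain ⟨ρ₀, hρ₀, hρ₀R, hSob⟩ := exists_frame_pointBound (Vf := Ξ) hR₀ (fun p ↦ (hΞs p).contDiffOn)
    (isUnit_frameMap_zero hΞ0)
  set ϱ : ℝ := min ρ₀ (R₀ / 4) with hϱ_def
  have hϱ0 : 0 < ϱ := lt_min hρ₀ (by positivity)
  have hϱρ₀ : ϱ ≤ ρ₀ := min_le_left _ _
  have hϱR : 2 * ϱ < R₀ := by
    have : ϱ ≤ R₀ / 4 := min_le_right _ _
    linarith
  obtain ⟨Csob, hCsob0, hCsob⟩ := hSob ϱ hϱ0 hϱρ₀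
  let θ : ContDiffBump (0 : Fin d → ℝ) := ⟨ϱ, 2 * ϱ, hϱ0, by linarith⟩
  have hθin : θ.rIn = ϱ := rfl
  have hθR : θ.rOut < R₀ := hϱR
  have hϱΩ : closedBall (0 : Fin d → ℝ) ϱ ⊆ Ω₀ :=
    (closedBall_subset_ball (by linarith : ϱ < R₀)).trans hballΩ
  obtain ⟨D, hD0, hskew⟩ := exists_pow_skew_const Ξ (fun p ↦ (hΞs p).contDiffOn) θ hθR P hPs Aop hPA
  set Mw : H.carrier → ℕ → (archSmooth ι) →ₗ[ℂ] Lp ℂ 2 (volume : Measure (Fin d → ℝ)) :=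
    fun y m ↦ powWeightMap θ (P y) (fun v ↦ (hPs y v).continuous) m with hMw_def
  /- Step 6: the relation `Δ^M f = -∑_{j<M} rⱼ Δ^j f` in `archSmooth` -/
  set f : archSmooth ι := ⟨F, (mem_archSmooth_iff _ _).2 hFs⟩ with hf_def
  have hΔpow : ∀ j, (((laplacianEnd Aop ^ j) f : archSmooth _) : H.carrier → ℂ) =
      (sqSumOp ι (basisLie B))^[j] F := fun j ↦ coe_laplacianEnd_pow_apply ρ hρ (basisLie B) j f
  -- the degenerate case `M = 0`: then `F = 0` and the curve is constant
  by_cases hM0 : Mdeg = 0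
  · subst hM0
    have hF0 : F = 0 := by
      funext x
      have h := hann' x
      rw [Finset.sum_range_one, hrM] at h
      simpa using h
    have hc0 : curve = fun _ ↦ 0 := by
      funext t
      simp [hcurve_def, hF0]
    change AnalyticAt ℝ curve 0
    rw [hc0]
    exact analyticAt_const
  have hA₀ : 1 ≤ Mdeg := Nat.one_le_iff_ne_zero.2 hM0
  set rr : ℕ → ℂ := fun j ↦ -(r j : ℂ) with hrr
  have hR : (laplacianEnd Aop ^ Mdeg) f = ∑ i ∈ Finset.range Mdeg, rr i • (laplacianEnd Aop ^ i) f := by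
    apply Subtype.ext
    rw [hΔpow, Submodule.coe_sum]
    funext x
    rw [Finset.sum_apply]
    simp only [Submodule.coe_smul, Pi.smul_apply, smul_eq_mul, hΔpow, hrr]
    have h := hann' x
    rw [Finset.sum_range_succ, hrM, Complex.ofReal_one, one_mul] at h
    rw [eq_neg_of_add_eq_zero_right h, ← Finset.sum_neg_distrib]
    refine Finset.sum_congr rfl fun j _ ↦ ?_
    ring
  /- Step 7: the finite-dimensional `Δ`-stable space `T` spanned by the `Δ^j f`, `j < M` -/
  set T : Submodule ℂ (archSmooth ι) :=
    Submodule.span ℂ (Set.range fun j : Fin Mdeg ↦ (laplacianEnd Aop ^ (j : ℕ)) f) with hT_def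
  have hfT : f ∈ T := Submodule.subset_span ⟨⟨0, hA₀⟩, by simp⟩
  have hT : ∀ u ∈ T, laplacianEnd Aop u ∈ T := by
    intro u hu
    have hu' : laplacianEnd Aop u ∈ T.map (laplacianEnd Aop) := Submodule.mem_map_of_mem hu
    rw [hT_def, Submodule.map_span] at hu'
    refine (Submodule.span_le.2 ?_) hu'
    rintro _ ⟨_, ⟨j, rfl⟩, rfl⟩
    change laplacianEnd Aop ((laplacianEnd Aop ^ (j : ℕ)) f) ∈ T
    rw [← Module.End.mul_apply, ← pow_succ']
    by_cases hj : (j : ℕ) + 1 < Mdeg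
    · exact Submodule.subset_span ⟨⟨(j : ℕ) + 1, hj⟩, rfl⟩
    · have hjM : (j : ℕ) + 1 = Mdeg := by have := j.2; omega
      rw [hjM, hR]
      refine Submodule.sum_mem _ fun i hi ↦ Submodule.smul_mem _ _ ?_
      exact Submodule.subset_span ⟨⟨i, Finset.mem_range.1 hi⟩, rfl⟩
  haveI : FiniteDimensional ℂ T := FiniteDimensional.span_of_finite ℂ (Set.finite_range _)
  haveI : Module.Free ℂ T := Module.Free.of_divisionRing ℂ T
  set bT := Module.finBasis ℂ T with hbT_def
  set dT : ℕ := Module.finrank ℂ T with hdT_def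
  obtain ⟨Bc, hBc0, hBc⟩ := exists_basisCoordSize_map_le bT (laplacianEnd Aop) hT
  /- Step 8: the compact arc `Y = h exp([-1, 1] X)` and the uniform bound of the basis of `T` near it -/
  set Y : Set H.carrier := (fun t : ℝ ↦ h * H.expMem (t • X)) '' Icc (-1 : ℝ) 1 with hY_def
  have hYc : IsCompact Y :=
    isCompact_Icc.image (continuous_const.mul (continuous_expMem_smul X))
  have hmemY : ∀ t ∈ Icc (-1 : ℝ) 1, h * H.expMem (t • X) ∈ Y := fun t ht ↦ ⟨t, ht, rfl⟩
  -- the basis functions are continuous on `H`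
  have hbcont : ∀ j, Continuous (((bT j : T) : archSmooth ι) : H.carrier → ℂ) := fun j ↦
    continuous_of_isArchSmooth_id hH hc ((mem_archSmooth_iff _ _).1 ((bT j : T) : archSmooth ι).2)
  have hKc : IsCompact (Y ×ˢ closedBall (0 : Fin d → ℝ) θ.rOut) := hYc.prod (isCompact_closedBall _ _)
  have hjb : ∀ j, ∃ Sj : ℝ, ∀ q ∈ Y ×ˢ closedBall (0 : Fin d → ℝ) θ.rOut,
      ‖(((bT j : T) : archSmooth ι) : H.carrier → ℂ) (q.1 * ι (chartExp B q.2))‖ ≤ Sj := by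
    intro j
    have hcq : Continuous fun q : H.carrier × (Fin d → ℝ) ↦
        (((bT j : T) : archSmooth ι) : H.carrier → ℂ) (q.1 * ι (chartExp B q.2)) :=
      (hbcont j).comp (continuous_fst.mul ((continuous_chartExp B).comp continuous_snd))
    obtain ⟨C, hC⟩ := hKc.exists_bound_of_continuousOn hcq.continuousOn
    exact ⟨C, hC⟩
  choose Sj hSj using hjb
  set S : ℝ := ∑ j, max (Sj j) 0 with hS_def
  have hS0 : 0 ≤ S := Finset.sum_nonneg fun j _ ↦ le_max_right _ _
  have hSle : ∀ j, ∀ y ∈ Y, ∀ x ∈ closedBall (0 : Fin d → ℝ) θ.rOut,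
      ‖(((bT j : T) : archSmooth ι) : H.carrier → ℂ) (y * ι (chartExp B x))‖ ≤ S := by
    intro j y hy x hx
    exact (hSj j ⟨y, x⟩ ⟨hy, hx⟩).trans ((le_max_left _ _).trans
      (Finset.single_le_sum (f := fun j ↦ max (Sj j) 0) (fun _ _ ↦ le_max_right _ _) (Finset.mem_univ j)))
  /- Step 9: the size `N` on `T` and the hypotheses of the a-priori estimate -/
  set Λ : ℝ := dT * S * powEnvNorm (d := d) θ with hΛ_def
  have hΛ0 : 0 ≤ Λ := by
    have := powEnvNorm_nonneg (d := d) θ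
    positivity
  set Nf : archSmooth ι → ℝ := fun w ↦ Λ * basisCoordSize bT w with hNf_def
  have hN0 : ∀ w ∈ T, 0 ≤ Nf w := fun w _ ↦ mul_nonneg hΛ0 (basisCoordSize_nonneg bT w)
  have hNB : ∀ w ∈ T, Nf (laplacianEnd Aop w) ≤ Bc * Nf w := by
    intro w hw
    calc Λ * basisCoordSize bT (laplacianEnd Aop w) ≤ Λ * (Bc * basisCoordSize bT w) :=
          mul_le_mul_of_nonneg_left (hBc w hw) hΛ0
      _ = Bc * (Λ * basisCoordSize bT w) := by ring
  -- the pointwise bound of the elements of `T` near `Y`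
  have hptw : ∀ w ∈ T, ∀ y ∈ Y, ∀ x ∈ closedBall (0 : Fin d → ℝ) θ.rOut,
      ‖P y w x‖ ≤ dT * S * basisCoordSize bT w := by
    intro w hw y hy x hx
    rw [hP_apply]
    have hexp := eq_sum_coord_smul_basis' bT hw
    have hval : ((w : archSmooth ι) : H.carrier → ℂ) (y * ι (chartExp B x)) =
        ∑ j, bT.equivFun ⟨w, hw⟩ j * (((bT j : T) : archSmooth ι) : H.carrier → ℂ) (y * ι (chartExp B x)) := by
      conv_lhs => rw [hexp]
      rw [Submodule.coe_sum, Finset.sum_apply]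
      refine Finset.sum_congr rfl fun j _ ↦ ?_
      rw [Submodule.coe_smul, Pi.smul_apply, smul_eq_mul]
    rw [hval]
    calc ‖∑ j, bT.equivFun ⟨w, hw⟩ j * (((bT j : T) : archSmooth ι) : H.carrier → ℂ) (y * ι (chartExp B x))‖
        ≤ ∑ j, ‖bT.equivFun ⟨w, hw⟩ j * (((bT j : T) : archSmooth ι) : H.carrier → ℂ) (y * ι (chartExp B x))‖ :=
          norm_sum_le _ _
      _ ≤ ∑ _j : Fin dT, basisCoordSize bT w * S := by
          refine Finset.sum_le_sum fun j _ ↦ ?_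
          rw [norm_mul]
          exact mul_le_mul (norm_coord_le_basisCoordSize bT hw j) (hSle j y hy x hx) (norm_nonneg _)
            (basisCoordSize_nonneg bT w)
      _ = dT * S * basisCoordSize bT w := by
          rw [Finset.sum_const, Finset.card_univ, Fintype.card_fin, nsmul_eq_mul]
          ring
  have hNM : ∀ y ∈ Y, ∀ w ∈ T, ‖Mw y 0 w‖ ≤ Nf w := by
    intro y hy w hw
    calc ‖Mw y 0 w‖ ≤ (dT * S * basisCoordSize bT w) * powEnvNorm (d := d) θ :=
          norm_powWeightMap_le_of_bound θ (P y) _ 0 w (fun x hx ↦ hptw w hw y hy x hx)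
      _ = Nf w := by simp only [hNf_def, hΛ_def]; ring
  /- Step 10: the a-priori estimate, uniformly on `Y`: all words, factorial growth -/
  set E : ℝ := Real.sqrt Bc + 2 * (d : ℝ) ^ 2 * cM + d * D with hE_def
  have hE0 : 0 ≤ E := by positivity
  set K₁ : ℝ := Real.exp 1 * Nf f with hK₁_def
  set E₁ : ℝ := E * Real.exp 1 with hE₁_def
  have hK₁0 : 0 ≤ K₁ := mul_nonneg (Real.exp_pos 1).le (hN0 f hfT)
  have hE₁0 : 0 ≤ E₁ := mul_nonneg hE0 (Real.exp_pos 1).le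
  have hW : ∀ y ∈ Y, ∀ α : List (Fin d),
      ‖Mw y α.length (wordEnd Aop α f)‖ ≤ K₁ * E₁ ^ α.length * α.length ! := by
    intro y hy α
    have key := norm_weight_wordEnd_le Aop cst hbr hcM0 hcle (Mw y)
      (fun m v ↦ norm_powWeightMap_succ_le θ (P y) _ m v) hD0 ?_ hT Nf hN0 (hNM y hy) hBc0 hNB
      α α.length le_rfl hfT
    · rw [Fintype.card_fin] at key
      refine key.trans ?_
      have h1 := aprioriBound_diag_le (B := Bc) hcM0 hD0 d α.length
      have h2 := mul_succ_pow_le_factorial hE0 α.length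
      calc aprioriBound Bc cM d D α.length α.length * Nf f
          ≤ (Real.exp 1 * (E * Real.exp 1) ^ α.length * α.length !) * Nf f :=
            mul_le_mul_of_nonneg_right (h1.trans h2) (hN0 f hfT)
        _ = K₁ * E₁ ^ α.length * α.length ! := by simp only [hK₁_def, hE₁_def]; ring
    · -- almost skewness, level by level
      intro m' hm' i u w
      obtain ⟨k, rfl⟩ : ∃ k : ℕ, m' = k + 1 := ⟨m' - 1, by omega⟩
      have hsk := hskew y k i u w
      rw [Nat.add_sub_cancel]
      refine hsk.trans (le_of_eq ?_)
      push_cast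
      ring
  /- Step 11: pointwise bounds of all words on `Y` (frame Sobolev bound at the base point) -/
  set Cp : ℝ := Csob * (∑ j ∈ Finset.range (d + 1), (d : ℝ) ^ j * (K₁ * (2 * E₁) ^ j * j !)) with hCp_def
  have hCp0 : 0 ≤ Cp := by positivity
  have hPt : ∀ y ∈ Y, ∀ γ : List (Fin d),
      ‖((wordEnd Aop γ f : archSmooth ι) : H.carrier → ℂ) y‖ ≤ Cp * (2 * E₁) ^ γ.length * γ.length ! := by
    intro y hy γ
    set v : archSmooth ι := wordEnd Aop γ f with hv_def
    set Fv : (Fin d → ℝ) → ℂ := P y v with hFv_def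
    have hFv0 : Fv 0 = (v : H.carrier → ℂ) y := by
      rw [hFv_def, hP_apply, chartExp_zero, map_one, mul_one]
    have hFvs : ContDiff ℝ ∞ Fv := hPs y v
    -- words of `Fv` in the chart are chart expressions of operator words, dominated by the weights
    have hword : ∀ (j : ℕ) (w : Fin j → Fin d),
        (∫ x in closedBall (0 : Fin d → ℝ) ϱ, ‖vfWord Ξ (List.ofFn w) Fv x‖ ^ (2 : ℝ)) ^ (1 / 2 : ℝ) ≤
          K₁ * (2 * E₁) ^ j * j ! * ((2 * E₁) ^ γ.length * γ.length !) := by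
      intro j w
      have heq : EqOn (vfWord Ξ (List.ofFn w) Fv)
          (P y (wordEnd Aop (List.ofFn w) v)) (closedBall 0 ϱ) := fun x hx ↦
        vfWord_chartFun_eqOn hΩ₀ hΞ ρ hρ y (List.ofFn w) v (hϱΩ hx)
      rw [setIntegral_congr_fun measurableSet_closedBall (fun x hx ↦ by rw [heq hx])]
      have hww : wordEnd Aop (List.ofFn w) v = wordEnd Aop (List.ofFn w ++ γ) f := by
        rw [hv_def, wordEnd_append, Module.End.mul_apply]
      have hlen : (List.ofFn w ++ γ).length = j + γ.length := by
        rw [List.length_append, List.length_ofFn]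
      calc (∫ x in closedBall (0 : Fin d → ℝ) ϱ, ‖P y (wordEnd Aop (List.ofFn w) v) x‖ ^ (2 : ℝ)) ^ (1 / 2 : ℝ)
          ≤ ‖Mw y (j + γ.length) (wordEnd Aop (List.ofFn w) v)‖ :=
            rpow_setIntegral_le_norm_powWeightMap θ (P y) _ (j + γ.length) _
        _ = ‖Mw y (List.ofFn w ++ γ).length (wordEnd Aop (List.ofFn w ++ γ) f)‖ := by rw [hww, hlen]
        _ ≤ K₁ * E₁ ^ (List.ofFn w ++ γ).length * (List.ofFn w ++ γ).length ! := hW y hy _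
        _ = K₁ * E₁ ^ (j + γ.length) * (((j + γ.length) ! : ℕ) : ℝ) := by rw [hlen]
        _ ≤ K₁ * E₁ ^ (j + γ.length) * ((2 : ℝ) ^ (j + γ.length) * j ! * γ.length !) :=
            mul_le_mul_of_nonneg_left (factorial_add_le_two_pow_mul j γ.length) (by positivity)
        _ = K₁ * (2 * E₁) ^ j * j ! * ((2 * E₁) ^ γ.length * γ.length !) := by
            rw [hE₁_def]; ring
    rw [← hFv0]
    refine (hCsob Fv hFvs).trans ?_
    have hk : ∀ j ∈ Finset.range (d + 1), ∑ w : Fin j → Fin d,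
        (∫ x in closedBall (0 : Fin d → ℝ) ϱ, ‖vfWord Ξ (List.ofFn w) Fv x‖ ^ (2 : ℝ)) ^ (1 / 2 : ℝ) ≤
          (d : ℝ) ^ j * (K₁ * (2 * E₁) ^ j * j !) * ((2 * E₁) ^ γ.length * γ.length !) := by
      intro j _
      calc ∑ w : Fin j → Fin d, (∫ x in closedBall (0 : Fin d → ℝ) ϱ, ‖vfWord Ξ (List.ofFn w) Fv x‖ ^ (2 : ℝ)) ^ (1 / 2 : ℝ)
          ≤ ∑ _w : Fin j → Fin d, K₁ * (2 * E₁) ^ j * j ! * ((2 * E₁) ^ γ.length * γ.length !) :=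
            Finset.sum_le_sum fun w _ ↦ hword j w
        _ = (d : ℝ) ^ j * (K₁ * (2 * E₁) ^ j * j !) * ((2 * E₁) ^ γ.length * γ.length !) := by
            rw [Finset.sum_const, Finset.card_univ, Fintype.card_fun, Fintype.card_fin, Fintype.card_fin,
              nsmul_eq_mul]
            push_cast
            ring
    calc Csob * ∑ j ∈ Finset.range (d + 1), ∑ w : Fin j → Fin d,
          (∫ x in closedBall (0 : Fin d → ℝ) ϱ, ‖vfWord Ξ (List.ofFn w) Fv x‖ ^ (2 : ℝ)) ^ (1 / 2 : ℝ)
        ≤ Csob * ∑ j ∈ Finset.range (d + 1),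
            (d : ℝ) ^ j * (K₁ * (2 * E₁) ^ j * j !) * ((2 * E₁) ^ γ.length * γ.length !) :=
          mul_le_mul_of_nonneg_left (Finset.sum_le_sum hk) hCsob0
      _ = Cp * (2 * E₁) ^ γ.length * γ.length ! := by
          rw [← Finset.sum_mul, hCp_def]; ring
  /- Step 12: the coordinates of `X`, the expansion of `X^k` into words, and the final bound -/
  set xc : Fin d → ℝ := fun p ↦ B.repr (eqv X) p with hxc_def
  set xM : ℝ := ∑ p, ‖(xc p : ℂ)‖ with hxM_def
  have hxM0 : 0 ≤ xM := Finset.sum_nonneg fun _ _ ↦ norm_nonneg _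
  have hρX : ρ X = ∑ p, (xc p : ℂ) • Aop p := by
    conv_lhs => rw [hbasis X, map_sum]
    refine Finset.sum_congr rfl fun p _ ↦ ?_
    rw [map_smul, real_smul_end_eq_coe_smul]
  have hderiv : ∀ (k : ℕ), ∀ y ∈ Y, ‖((lieDeriv ι X)^[k] F) y‖ ≤ Cp * (xM * (2 * E₁)) ^ k * k ! := by
    intro k y hy
    have hcoe : (lieDeriv ι X)^[k] F = ((((ρ X) ^ k) f : archSmooth ι) : H.carrier → ℂ) :=
      (coe_pow_lieHom_apply ρ hρ X k f).symm
    have hexp : ((ρ X) ^ k) f = ∑ β : Fin k → Fin d, (∏ i, (xc (β i) : ℂ)) • wordEnd Aop (List.ofFn β) f := by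
      have h := wordEnd_pow_sum_smul_apply Aop (fun p ↦ (xc p : ℂ)) k [] f
      simp only [wordEnd_nil, Module.End.one_apply, List.nil_append] at h
      rw [← hρX] at h
      exact h
    rw [hcoe, hexp, Submodule.coe_sum, Finset.sum_apply]
    calc ‖∑ β : Fin k → Fin d, (((∏ i, (xc (β i) : ℂ)) • wordEnd Aop (List.ofFn β) f : archSmooth ι) :
            H.carrier → ℂ) y‖
        ≤ ∑ β : Fin k → Fin d, ‖(((∏ i, (xc (β i) : ℂ)) • wordEnd Aop (List.ofFn β) f : archSmooth ι) :
            H.carrier → ℂ) y‖ := norm_sum_le _ _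
      _ ≤ ∑ β : Fin k → Fin d, (∏ i, ‖(xc (β i) : ℂ)‖) * (Cp * (2 * E₁) ^ k * k !) := by
          refine Finset.sum_le_sum fun β _ ↦ ?_
          rw [Submodule.coe_smul, Pi.smul_apply, smul_eq_mul, norm_mul, norm_prod]
          refine mul_le_mul_of_nonneg_left ?_ (Finset.prod_nonneg fun _ _ ↦ norm_nonneg _)
          have h := hPt y hy (List.ofFn β)
          rwa [List.length_ofFn] at h
      _ = xM ^ k * (Cp * (2 * E₁) ^ k * k !) := by
          rw [← Finset.sum_mul, sum_prod_eq_sum_pow (fun p ↦ ‖(xc p : ℂ)‖) k]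
      _ = Cp * (xM * (2 * E₁)) ^ k * k ! := by rw [mul_pow]; ring
  /- Step 13: Taylor's formula -/
  change AnalyticAt ℝ curve 0
  refine Literature.NumberTheory.Automorphic.analyticAt_of_norm_iteratedDeriv_le_on hsmooth one_pos 0
    (M := Cp) (C := xM * (2 * E₁)) fun k t ht ↦ ?_
  rw [hiter k]
  have ht' : t ∈ Icc (-1 : ℝ) 1 := by simpa using ht
  exact hderiv k _ (hmemY t ht')

end Main

end Literature.NumberTheory.Automorphic
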